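import Summits.QuantumFields.YangMills.Theses.ConvexGribovBody
import Literature.MathematicalPhysics.QuantumLattice.TorusWilsonMarkov
import Literature.MathematicalPhysics.QuantumLattice.WilsonBlockHeatBathSemigroup
import Literature.MathematicalPhysics.QuantumLattice.WilsonBlockHeatBathMarkov3
import Literature.MathematicalPhysics.QuantumLattice.WilsonBlockHeatBathLightCone2
import Summits.QuantumFields.YangMills.Theorems.FradkinShenkerFlowSusceptibilityToPoincareTwoBlockFactorization
import Summits.QuantumFields.YangMills.Theorems.ConvexGribovBodyPoincareToGapKernelVersion
import Summits.QuantumFields.YangMills.Theorems.ConvexGribovBodyPoincareToGapPeelingDecay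
import Summits.QuantumFields.YangMills.Theorems.ConvexGribovBodyPoincareToGapClusteringAssembly
import Summits.QuantumFields.YangMills.Theorems.ConvexGribovBodyPoincareToGapDuality
import Summits.QuantumFields.YangMills.Theorems.ConvexGribovBodyPoincareToGapGlue
import Summits.QuantumFields.YangMills.Theorems.ConvexGribovBodyPoincareToGapRetentionToGap
import Summits.QuantumFields.YangMills.Theorems.ConvexGribovBodyPoincareToGapSliceCovSum
import Summits.QuantumFields.YangMills.Theorems.ConvexGribovBodyPoincareToGapAxisSwap
import Summits.QuantumFields.YangMills.Theorems.ConvexGribovBodyPoincareToGapAxisSwapTransport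
import Summits.QuantumFields.YangMills.Theorems.ConvexGribovBodyPoincareToGapCovLogConvex
import Summits.QuantumFields.YangMills.Theorems.ConvexGribovBodyPoincareToGapAntitone
import Summits.QuantumFields.YangMills.Theorems.ConvexGribovBodyBrascampLiebVacuumStubRpHankel
import Summits.QuantumFields.YangMills.Theorems.ConvexGribovBodyPoincareToGapCrossCov
import Summits.QuantumFields.YangMills.Theorems.ConvexGribovBodyPoincareToGapTimeReflect
import Summits.QuantumFields.YangMills.Theorems.ConvexGribovBodyPoincareToGapPlaquette
import Summits.QuantumFields.YangMills.Theorems.ConvexGribovBodyPoincareToGapTemporalDecay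
import Summits.QuantumFields.YangMills.Theorems.ConvexGribovBodyPoincareToGapPairDecay
import Summits.QuantumFields.YangMills.Theorems.ConvexGribovBodyPoincareToGapTimeShift
import Summits.QuantumFields.YangMills.Theorems.ConvexGribovBodyPoincareToGapRetentionOfSmoothWitness
import Summits.QuantumFields.YangMills.Theorems.ConvexGribovBodyPoincareToGapProjectionOfRetention
import Summits.QuantumFields.YangMills.Theorems.ConvexGribovBodyPoincareToGapProjectionBoundOfSmoothWitness
import Summits.QuantumFields.YangMills.Theorems.ConvexGribovBodyPoincareToGapGapOfTwoSlicePoincare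

/-!
# Line `Sketch` (cyclic peeling) — checked skeleton for crux stmt-QuantumFields-8781
(`Summit.QuantumFields.YangMills.Theses.ConvexGribovBody.PoincareToGap`:
time-zero slice Poincaré ⇒ volume-uniform exponential time-clustering on the tori `(2S+1)⁴`)

LEAD `prover-line-stmt-QuantumFields-8781-0` (opening lead, gen 1, 2026-08-16).  The only line handed over
(`payload.lines = [Sketch]`: ideator-1 cards `two-sided-cramer-rao` + `cyclic-peeling`, whose `Sketch.lean`
typed `poincareToGap_of : C⁺ → C⁺⁺ → PoincareToGap`) is OWNED here in the reshaped form below: the torus-native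
CYCLIC PEELING composition (C⁺ = "two-time arc retention ⇒ clustering", provable now, split into three
registered stubs over the tree's Gibbs/Markov/heat-bath toolkit) and ONE analytic heart (C⁺⁺ = "slice Poincaré ⇒
two-time arc retention", held by the lead).  `PoincareToGap_of` proves the crux BY NAME from the four stubs.

## Objects (torus `(ℤ/(2S+1))⁴`, time = coordinate `0`, `μ = wilsonMeasure r.ρ β`)

* slice `t` := the links BASED at time `t` (spatial `(t,x,i≠0)` and temporal `(t,x,0)`); Wilson's plaquettes span
  at most two consecutive slices, so `μ` is MARKOV IN TIME (tree: `isGibbsMeasure_wilsonMeasure`,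
  `stronglyMeasurable_and_ae_eq_condExp_integral_gibbsSpecOfPotential`, pattern `condExp_wilsonMeasure_markov_slab`,
  `WilsonBlockHeatBath.exists_local_condExp_version`);
* the ARC of length `ℓ` from time `s` := links `e` with `(e.1 0 - s).val < ℓ`; its complement
  `{e | ℓ ≤ (e.1 0 - s).val}`; its two END slices are the offsets `0` and `ℓ - 1`; its two OUTER boundary slices
  are the offsets `ℓ` and `2S` (= time `s - 1`);
* `P_D := condExp (cylinderEvents D) μ` (conditional expectation given the links in `D`).

## The line: Cov(f, τ_n g) = ∫ F_k · g with ‖F_{j+1}‖₂² ≤ (1 − ε) ‖F_j‖₂²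

Peeling: `F₀ = f − ∫ f` (supported in the arc `A₀` of `f`), `F_{j+1}` := a bounded measurable gauge-invariant
version of `P_{A_jᶜ} F_j` reading ONLY the spatial links of the two outer boundary slices of `A_j`
(`stub_kernelVersion`: DLR kernel = local version; gauge averaging; gauge invariance kills the temporal links of
the lower boundary slice), `A_{j+1} := A_j` grown by one slice on each side.  As long as `supp g ⊆ A_jᶜ`,
`∫ F_{j+1} g = ∫ F_j g` (pull-out), `∫ F_{j+1} = 0`, and by Pythagoras + TWO-TIME ARC RETENTION
(`ε·Var F ≤ ∫ (F − P_{arcᶜ}F)²` for gauge-invariant bounded `F` reading the spatial links of the two end slices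
of the arc) `∫ F_{j+1}² ≤ (1 − ε) ∫ F_j²` for `j ≥ 1` (`stub_peelingDecay`).  With `k ≍ n − w_A − w_B` peeling
steps available between the supports of `A` and `τ_n B` on BOTH sides of the cycle (`n ≤ S`),
`|corr(n)| ≤ 2 C_A C_B (1−ε)^{k/2} ≤ C e^{−(ε/2) n}` (`stub_clusteringAssembly`, with the tree's
`latticeConnectedCorr_eq_integral_sub`, `shiftedObservable_props`, `abs_latticeConnectedCorr_le_two_mul`).
The heart `stub_twoTimeRetention_of_slicePoincare` turns the crux's hypothesis (slice Poincaré with constant κ on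
all tori `S ≥ S₀`, restated WITHOUT `let`) into two-time arc retention with some `ε(G, r, β, κ) ∈ (0, 1]`,
`S ≥ S₁`.  No transfer matrix, no ground state, no thermal trace, no reflection positivity is used anywhere.

Stubs (five after reshape 1; registered; sizes are guesses):
  P1 `stub_kernelVersion`       [M+, provable now] local + gauge-invariant version of `P_{arcᶜ} f` on the two
     outer boundary slices, spatial links only.
  P2 `stub_peelingDecay`        [M+/L, provable now] the peeling induction: kernel versions + retention(ε) on one
     torus ⇒ `|∫ f g − ∫ f ∫ g| ≤ 2 M_f M_g √(1−ε)^k` for `f` in an arc of width `w`, `g` at offset distance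
     `≥ k` from it on both sides, `w + 2k + 3 ≤ 2S+1`.
  P3 `stub_clusteringAssembly`  [M, provable now] P2's conclusion for all `S ≥ S₁` ⇒ the crux's conclusion
     (`m = ε/2`, `C = 2 C_A C_B e^{ε(M_A+M_B+2)/2}`, `S₂ = S₁`; small `n` by the a priori bound).
  H1a `stub_retention_of_projectionBound` [M, LANDED p104460] DUALITY: for any link sets `E, O`, a projection
     bound `Var(E[h|𝓕_E]) ≤ θ Var h` for gauge-invariant bounded `h` reading `O` gives retention
     `(1−θ) Var F ≤ ∫ (F − E[F|𝓕_O])²` for gauge-invariant bounded `F` reading `E`.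
  H1b `stub_projectionBound_of_slicePoincare` [XL, OPEN — the heart, held by the lead] slice Poincaré(κ) on all
     tori `S ≥ S₀` ⇒ `∃ θ < 1, S₁`: on all tori `S ≥ S₁`, all arcs `3 ≤ ℓ ≤ 2S − 2`, the spatial links of the two
     END slices of the arc carry at most the fraction `θ` of the variance of any gauge-invariant bounded `h`
     reading only links outside the arc.  Honest knots (lead's NOTES/Census): (K-a) for ONE end slice the bound
     follows from slice Poincaré applied to the explicit kernel version of `E[h|X]`, whose metric slope is
     `≤ β ‖Cov(h, M_ℓ | X)‖_F` (`M_ℓ` = the two temporal staples at `ℓ`; calculus-free), GIVEN a volume-uniform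
     bound on the conditional covariance operator of the staples ("staple susceptibility", exact `2/β` in the
     Gaussian calibration by Brascamp–Lieb); (K-b) the second end slice requires the same for one slice
     CONDITIONALLY on a far slice — intrinsic to the torus (every arc complement has two boundary slices).
  (Reshape 1, 2026-08-16: the first registered heart `stub_twoTimeRetention_of_slicePoincare` = H1a ∘ H1b is now
  the THEOREM `twoTimeRetention_of_slicePoincare` of §2; P1–P3 are LANDED tree theorems p98435/p100144/p101620.)
Composition (sorry-free): H1b gives `θ, S₁`; H1a turns it into retention `ε = 1 − θ`; for `S ≥ S₁`, P2 fed with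
P1 and the retention gives the peeling decay; P3 turns it into the crux conclusion; `PoincareToGap_of` is the
crux BY NAME (the crux hypothesis, a `let`-cascade, is passed to H1b's `let`-free restatement by definitional
unfolding).

Disproof.lean: none exists for this crux at registration time (`payload.disproof_path` absent from the jail and
from `Cruxes/PoincareToGap/`; `ledger crux ls`: Ideas only).  Refuter census honoured (EVIDENCE.md via item notes):
the `𝓝[≠]`-slope is consumed only inside H1; P1–P3 are junk-free measure theory on a probability space.
Signatures are spelled over tree/Mathlib declarations only; measures enter through `∀ μ, μ = wilsonMeasure … →`
binders (no `:=` inside a signature).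

CONTINUATION LEAD `prover-line-stmt-QuantumFields-8781-c1-0` (2026-08-16/17), RESHAPE 2: the composition factors through two
hypothesis-free stubs C1 `stub_twoTimeRetention_of_projectionBounds` (PB1 ∧ PB2 ⇒ Retention; = G1 + H1a; proposed p132792)
and C2 `stub_gapAt_of_twoTimeRetention` (Retention ⇒ GapAt; = P3 ∘ P2 ∘ P1; LANDED p122459), the planner-facing
interfaces of Cruxes/PoincareToGap/NOTES.md §8.3.  All seven landed/proved stubs (P1 p98435, P2 p100144, P3 p101620,
H1a p104460, G1 p106765, C1, C2) are cited or proved inline; this file has EXACTLY two sorries: the open cores PB1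
(`stub_oneSliceProjectionBound_of_slicePoincare`) and PB2 (`stub_conditionalProjectionBound_of_slicePoincare`), both
crux-sized (NOTES §1–§8; wave-1 worker: PB2 ⟸ PinnedOneSliceProjectionBound, typed in the seat's evidence file).

CONTINUATION LEAD `prover-line-stmt-QuantumFields-8781-c2-0` (2026-08-17), RESHAPE 3 (additive): `PoincareToGap_of` and the
two open cores PB1/PB2 are untouched; §1c registers five PROVABLE stubs F1 `stub_sliceCovSum_le`, F2
`stub_wilsonMeasure_map_axisSwap`, F3 `stub_axisSwap_transport`, F4 `stub_cov_nonneg_logConvex`, F4b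
`stub_antitone_of_logConvex`, composed sorry-free in §3 into `temporalDecay_of_slicePoincare`: the crux HYPOTHESIS ALONE
(symmetric torus: axis swap `0 ↔ 1` + odd-torus reflection positivity) gives `Cov_S(A, τ_n A) ≤ κ·dir(A)/(n+1)` for
`n ≤ S` and every gauge-invariant link-Lipschitz `(2,3)`-layer observable `A` — volume-uniform power-law temporal
clustering; the exponential rate is exactly what PB1 ∧ PB2 add.  Wave 1 (five stub-workers) LANDED F1 p146864, F2 p145329,
F3 p145575, F4 p146262, F4b p145324; §3 is a tree-closed theorem.  Sorries of this file: PB1, PB2 (the open cores).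

CONTINUATION LEAD `prover-line-stmt-QuantumFields-8781-c3-0` (2026-08-17), RESHAPE 4: PB1 is no longer a stub but the
THEOREM `oneSliceProjectionBound_of_slicePoincare` of §1e, composed from four registered stubs: T1
`stub_sliceHypothesis_timeShift` (provable: the slice Poincaré hypothesis transported from the time-zero slice to every
slice `s` by the time translation `T⁰_s`, an invariance of `μ`), SW `stub_smoothWitness` (the OPEN heart, HYPOTHESIS-FREE
and `β`-local: every bounded gauge-invariant one-slice function `F` has an admissible — gauge-invariant, one-slice,
link-Lipschitz — witness `F₁` with `dir_s(F₁)/β + ‖F − F₁‖² ≤ C · ‖F − E_μ[F | X_sᶜ]‖²`; this is the K-functional form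
of the strategist's SMOOTH-WITNESS / S⁺ (STRATEGY-CENSUS §0, §Strengthen), typable over tree objects because the
saturating functional `inf (dir/β + ‖·‖²)` replaces the semigroup `1 − e^{−D/β}`), L1 `stub_retention_of_smoothWitness`
(provable `L²` algebra: hypothesis at slice `s` ∧ SW ⇒ one-slice retention `Var F ≤ 2 max(κβ,1) C ‖F − E[F|X_sᶜ]‖²`) and
L2 `stub_oneSliceProjectionBound_of_retention` (provable: one-slice retention ⇒ PB1's projection bound, by the landed
duality H1a with the roles of the two link sets exchanged, plus Pythagoras).  PB2 is untouched.  Wave 1 (three stub-workers)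
LANDED T1 p155704, L1 p156157, L2 p156414.  Sorries of this file: SW, PB2 (the two hearts).
-/

noncomputable section

open scoped BigOperators Topology
open MeasureTheory ProbabilityTheory Filter
open Literature.MathematicalPhysics.QuantumFieldTheory Literature.MathematicalPhysics.QuantumLattice

namespace Summit.QuantumFields.YangMills.Cruxes.PoincareToGap.CyclicPeeling

/-! ### §1 The stubs (the ONLY sorries of this file: PB1, PB2; P1–P3, H1a, G1 are landed tree theorems) -/

/-- `stub_kernelVersion` — **local gauge-invariant version of the heat-bath average over a time arc** (P1;
provable now, size M+).  For the torus Wilson state `μ`, an arc of slices of length `ℓ` from time `s`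
(`1 ≤ ℓ ≤ 2S`) and a bounded measurable gauge-invariant `f` reading only links based in the arc, the
conditional expectation of `f` given the links based OUTSIDE the arc has a version which is measurable, bounded
by the same constant, gauge-invariant everywhere, and reads only the SPATIAL links of the two outer boundary
slices (offsets `ℓ` and `2S` from `s`).  Proof: the DLR kernel of the plaquette potential is a local version
(`WilsonBlockHeatBath.exists_local_condExp_version` with `T` = slice `s−1` ∪ spatial part of slice `s+ℓ`:
a plaquette meeting the arc lies in the arc ∪ `T`); average it over the compact gauge group
(`WilsonBlockHeatBathMarkov3.exists_isGaugeInvariant_version`, keeping `DependsOn T`, using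
`condExp_linkSigma_comp_gaugeTransform` and the gauge invariance of `f`); finally an everywhere gauge-invariant
function reading only `T` does not read the temporal links of slice `s−1` (gauge transformation supported on
the time-`s` sites). -/
theorem stub_kernelVersion :
    ∀ (G : Type) [Group G] [TopologicalSpace G] [IsTopologicalGroup G] [CompactSpace G]
      [MeasurableSpace G] [BorelSpace G] (r : LatticeRep G) (β : ℝ) (S : ℕ)
      (μ : Measure (GaugeConfig 4 (2 * S + 1) G)),
      μ = (wilsonMeasure r.ρ β : Measure (GaugeConfig 4 (2 * S + 1) G)) →
    ∀ (s : ZMod (2 * S + 1)) (ℓ : ℕ), 1 ≤ ℓ → ℓ + 1 ≤ 2 * S + 1 →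
    ∀ (f : GaugeConfig 4 (2 * S + 1) G → ℝ) (M : ℝ), Measurable f → (∀ U, |f U| ≤ M) →
      IsGaugeInvariant f → DependsOn f {e : Edge 4 (2 * S + 1) | (e.1 0 - s).val < ℓ} →
    ∃ F : GaugeConfig 4 (2 * S + 1) G → ℝ, Measurable F ∧ (∀ U, |F U| ≤ M) ∧ IsGaugeInvariant F ∧
      DependsOn F {e : Edge 4 (2 * S + 1) |
        ((e.1 0 - s).val = ℓ ∨ (e.1 0 - s).val = 2 * S) ∧ e.2 ≠ 0} ∧
      F =ᵐ[μ] condExp (cylinderEvents {e : Edge 4 (2 * S + 1) | ℓ ≤ (e.1 0 - s).val}) μ f :=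
  Summit.QuantumFields.YangMills.Theorems.PoincareToGap.stub_kernelVersion

/-- `stub_peelingDecay` — **the cyclic peeling induction on one torus** (P2; provable now, size M+/L).
Hypotheses (interfaces, for the fixed torus `S` and `μ = wilsonMeasure r.ρ β`): the kernel-version property of
`stub_kernelVersion` and two-time arc retention with constant `ε ∈ (0, 1]`.  Conclusion: for `f` bounded
measurable gauge-invariant reading only the arc of width `w ≥ 1` from time `a`, and `g` bounded measurable
reading only links at offsets `w + k ≤ · ≤ 2S − k` from `a` (distance `≥ k` from the arc on both sides of the
cycle), with room `w + 2k + 3 ≤ 2S + 1`:  `|∫ f g − ∫ f ∫ g| ≤ 2 M_f M_g (√(1−ε))^k`.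
Proof: `F₀ := f − ∫ f`; for `j ≤ k`, `F_{j+1}` := the kernel version of `P_{A_jᶜ} F_j`, `A_j` = arc of length
`w + 2j` from `a − j` (the boundary set of `A_j` IS the end set of `A_{j+1}`: a `ZMod.val` identity); pull-out
(`TwoBlock.integral_condExp_mul`, `g` is `cylinderEvents A_jᶜ`-measurable by
`Measurable.measurable_cylinderEvents_of_dependsOn`) gives `∫ F_{j+1} g = ∫ F_j g` and `∫ F_{j+1} = 0`;
Pythagoras (`TwoBlock.integral_sub_condExp_sq`) + retention at the arc `A_j` (`j ≥ 1`) give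
`∫ F_{j+1}² ≤ (1−ε) ∫ F_j²`, and `∫ F₁² ≤ ∫ F₀² ≤ (2M_f)²`; finish with Cauchy–Schwarz
(`TwoBlock.integral_mul_le_sqrt_mul_sqrt`). -/
theorem stub_peelingDecay :
    ∀ (G : Type) [Group G] [TopologicalSpace G] [IsTopologicalGroup G] [CompactSpace G]
      [MeasurableSpace G] [BorelSpace G] (r : LatticeRep G) (β : ℝ) (S : ℕ)
      (μ : Measure (GaugeConfig 4 (2 * S + 1) G)),
      μ = (wilsonMeasure r.ρ β : Measure (GaugeConfig 4 (2 * S + 1) G)) →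
    ∀ ε : ℝ, 0 < ε → ε ≤ 1 →
    (∀ (s : ZMod (2 * S + 1)) (ℓ : ℕ), 1 ≤ ℓ → ℓ + 1 ≤ 2 * S + 1 →
      ∀ (f : GaugeConfig 4 (2 * S + 1) G → ℝ) (M : ℝ), Measurable f → (∀ U, |f U| ≤ M) →
        IsGaugeInvariant f → DependsOn f {e : Edge 4 (2 * S + 1) | (e.1 0 - s).val < ℓ} →
      ∃ F : GaugeConfig 4 (2 * S + 1) G → ℝ, Measurable F ∧ (∀ U, |F U| ≤ M) ∧ IsGaugeInvariant F ∧
        DependsOn F {e : Edge 4 (2 * S + 1) |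
          ((e.1 0 - s).val = ℓ ∨ (e.1 0 - s).val = 2 * S) ∧ e.2 ≠ 0} ∧
        F =ᵐ[μ] condExp (cylinderEvents {e : Edge 4 (2 * S + 1) | ℓ ≤ (e.1 0 - s).val}) μ f) →
    (∀ (s : ZMod (2 * S + 1)) (ℓ : ℕ), 3 ≤ ℓ → ℓ + 3 ≤ 2 * S + 1 →
      ∀ F : GaugeConfig 4 (2 * S + 1) G → ℝ, Measurable F → (∃ M : ℝ, ∀ U, |F U| ≤ M) →
        IsGaugeInvariant F →
        DependsOn F {e : Edge 4 (2 * S + 1) |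
          ((e.1 0 - s).val = 0 ∨ (e.1 0 - s).val = ℓ - 1) ∧ e.2 ≠ 0} →
      ε * ∫ U, (F U - ∫ V, F V ∂μ) ^ 2 ∂μ ≤
        ∫ U, (F U - condExp (cylinderEvents {e : Edge 4 (2 * S + 1) | ℓ ≤ (e.1 0 - s).val}) μ F U) ^ 2 ∂μ) →
    ∀ (a : ZMod (2 * S + 1)) (w k : ℕ), 1 ≤ w → w + 2 * k + 3 ≤ 2 * S + 1 →
    ∀ (f g : GaugeConfig 4 (2 * S + 1) G → ℝ) (Mf Mg : ℝ),
      Measurable f → (∀ U, |f U| ≤ Mf) → IsGaugeInvariant f →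
      DependsOn f {e : Edge 4 (2 * S + 1) | (e.1 0 - a).val < w} →
      Measurable g → (∀ U, |g U| ≤ Mg) →
      DependsOn g {e : Edge 4 (2 * S + 1) | w + k ≤ (e.1 0 - a).val ∧ (e.1 0 - a).val + k ≤ 2 * S} →
    |∫ U, f U * g U ∂μ - (∫ U, f U ∂μ) * ∫ U, g U ∂μ| ≤ 2 * Mf * Mg * Real.sqrt (1 - ε) ^ k :=
  Summit.QuantumFields.YangMills.Theorems.PoincareToGap.stub_peelingDecay

/-- `stub_clusteringAssembly` — **from peeling decay on all large tori to the crux's clustering body** (P3;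
provable now, size M).  If for every `S ≥ S₁` the torus Wilson state satisfies the peeling-decay estimate of
`stub_peelingDecay` with one `ε ∈ (0, 1]`, then every pair of local gauge-invariant observables clusters in
time at rate `m = ε/2` on all tori `S ≥ S₁`, `n ≤ S`.  Proof: write the correlation with both observables read
through the shifted periodic lift (`latticeConnectedCorr_eq_integral_sub`), whose factors are bounded
measurable gauge-invariant and read only the projected shifted supports (`WilsonBlockHeatBath.shiftedObservable_props`);
with `M_A, M_B` bounding `|e.1 0|` on the supports, `f` reads the arc of width `2M_A+1` from `a = −M_A` and
`τ_n g` the offsets `[n−M_B+M_A, n+M_B+M_A]` (a `ZMod.val` computation, no wrap since `n + M_A + M_B ≤ 2S`);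
take `k = n − M_A − M_B − 2` when this is `≥ 0` (then all side conditions hold because `n ≤ S`) and the a priori
bound `abs_latticeConnectedCorr_le_two_mul` otherwise; `√(1−ε)^k ≤ e^{−εk/2}` gives
`C = 2 C_A C_B e^{ε(M_A+M_B+2)/2}`. -/
theorem stub_clusteringAssembly :
    ∀ (G : Type) [Group G] [TopologicalSpace G] [IsTopologicalGroup G] [CompactSpace G]
      [MeasurableSpace G] [BorelSpace G] (r : LatticeRep G) (β ε : ℝ), 0 < ε → ε ≤ 1 → ∀ S₁ : ℕ,
    (∀ S : ℕ, S₁ ≤ S → ∀ μ : Measure (GaugeConfig 4 (2 * S + 1) G),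
      μ = (wilsonMeasure r.ρ β : Measure (GaugeConfig 4 (2 * S + 1) G)) →
      ∀ (a : ZMod (2 * S + 1)) (w k : ℕ), 1 ≤ w → w + 2 * k + 3 ≤ 2 * S + 1 →
      ∀ (f g : GaugeConfig 4 (2 * S + 1) G → ℝ) (Mf Mg : ℝ),
        Measurable f → (∀ U, |f U| ≤ Mf) → IsGaugeInvariant f →
        DependsOn f {e : Edge 4 (2 * S + 1) | (e.1 0 - a).val < w} →
        Measurable g → (∀ U, |g U| ≤ Mg) →
        DependsOn g {e : Edge 4 (2 * S + 1) | w + k ≤ (e.1 0 - a).val ∧ (e.1 0 - a).val + k ≤ 2 * S} →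
      |∫ U, f U * g U ∂μ - (∫ U, f U ∂μ) * ∫ U, g U ∂μ| ≤ 2 * Mf * Mg * Real.sqrt (1 - ε) ^ k) →
    ∃ m : ℝ, 0 < m ∧ ∃ S₂ : ℕ, ∀ A B : YMSpecies G, ∃ C : ℝ, ∀ S n : ℕ, S₂ ≤ S → n ≤ S →
      |latticeConnectedCorr r.ρ β (2 * S + 1) A.F B.F n| ≤ C * Real.exp (-(m * n)) :=
  Summit.QuantumFields.YangMills.Theorems.PoincareToGap.stub_clusteringAssembly

/-- `stub_retention_of_projectionBound` — **DUALITY (H1a; provable now, size M)**: variance retention under a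
heat-bath projection is the dual of a projection bound.  For the torus Wilson state `μ`, ANY two link sets
`E, O` and `0 ≤ θ`: if every bounded measurable gauge-invariant `h` reading only the links of `O` has
`Var(E_μ[h | 𝓕_E]) ≤ θ · Var h`, then every bounded measurable gauge-invariant `F` reading only the links of `E`
keeps the fraction `1 − θ` of its variance when the complement of `O` is resampled:
`(1 − θ) Var F ≤ ∫ (F − E_μ[F | 𝓕_O])²`.  Proof: with `F₀ = F − ∫F` and `h` a bounded measurable
gauge-invariant version of `P_O F₀` reading only `O` (truncated `𝓕_O`-measurable version + Haar gauge averaging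
keeping locality, as in `stub_kernelVersion`; gauge covariance of `condExp`), pull-out twice gives
`‖P_O F₀‖² = ∫ F₀ h = ∫ F₀ (P_E h − ∫ h) ≤ ‖F₀‖ √θ ‖h‖ = √θ ‖F₀‖ ‖P_O F₀‖`, hence `‖P_O F₀‖² ≤ θ ‖F₀‖²` and
Pythagoras. -/
theorem stub_retention_of_projectionBound :
    ∀ (G : Type) [Group G] [TopologicalSpace G] [IsTopologicalGroup G] [CompactSpace G]
      [MeasurableSpace G] [BorelSpace G] (r : LatticeRep G) (β : ℝ) (S : ℕ)
      (μ : Measure (GaugeConfig 4 (2 * S + 1) G)),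
      μ = (wilsonMeasure r.ρ β : Measure (GaugeConfig 4 (2 * S + 1) G)) →
    ∀ (E O : Set (Edge 4 (2 * S + 1))) (θ : ℝ), 0 ≤ θ →
    (∀ h : GaugeConfig 4 (2 * S + 1) G → ℝ, Measurable h → (∃ M : ℝ, ∀ U, |h U| ≤ M) →
      IsGaugeInvariant h → DependsOn h O →
      ∫ U, (condExp (cylinderEvents E) μ h U - ∫ V, h V ∂μ) ^ 2 ∂μ ≤
        θ * ∫ U, (h U - ∫ V, h V ∂μ) ^ 2 ∂μ) →
    ∀ F : GaugeConfig 4 (2 * S + 1) G → ℝ, Measurable F → (∃ M : ℝ, ∀ U, |F U| ≤ M) →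
      IsGaugeInvariant F → DependsOn F E →
    (1 - θ) * ∫ U, (F U - ∫ V, F V ∂μ) ^ 2 ∂μ ≤
      ∫ U, (F U - condExp (cylinderEvents O) μ F U) ^ 2 ∂μ :=
  Summit.QuantumFields.YangMills.Theorems.PoincareToGap.stub_retention_of_projectionBound

/-- `stub_projectionBound_glue` — **one-slice bound ∧ conditional bound ⇒ two-slice bound (G1; LANDED p106765
after the worker's correction `1 ≤ ℓ` — for `ℓ = 0` the registered first version was false; pure Hilbert-space
algebra)**.  On one torus, for the arc of `ℓ` slices from `s`, with `X_s` = the spatial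
links at time `s` (offset `0`) and `E` = the spatial links of the two end slices (offsets `0`, `ℓ − 1`):
if `Var(P_{X_s} h) ≤ θ₁ Var h` for gauge-invariant bounded `h` reading links other than `X_s` (PB1) and
`‖P_E h − P_{X_s} h‖² ≤ θ₂ ‖h − P_{X_s} h‖²` for gauge-invariant bounded `h` reading links outside the arc (PB2,
`θ₂ ≤ 1`), then `Var(P_E h) ≤ (θ₁ + θ₂ − θ₁θ₂) Var h` for the latter class.  Proof: `σ(X_s) ⊆ σ(E)` gives
`P_{X_s} P_E = P_{X_s}`, so `Var(P_E h) = Var(P_{X_s} h) + ‖P_E h − P_{X_s} h‖²` (Pythagoras / tower) and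
`‖h − P_{X_s}h‖² = Var h − Var(P_{X_s} h)`; then `a + θ₂(V − a) ≤ θ₁(1−θ₂)V + θ₂V`. -/
theorem stub_projectionBound_glue :
    ∀ (G : Type) [Group G] [TopologicalSpace G] [IsTopologicalGroup G] [CompactSpace G]
      [MeasurableSpace G] [BorelSpace G] (r : LatticeRep G) (β : ℝ) (S : ℕ)
      (μ : Measure (GaugeConfig 4 (2 * S + 1) G)),
      μ = (wilsonMeasure r.ρ β : Measure (GaugeConfig 4 (2 * S + 1) G)) →
    ∀ (s : ZMod (2 * S + 1)) (ℓ : ℕ) (θ₁ θ₂ : ℝ), 0 ≤ θ₁ → 0 ≤ θ₂ → θ₂ ≤ 1 → 1 ≤ ℓ →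
    (∀ h : GaugeConfig 4 (2 * S + 1) G → ℝ, Measurable h → (∃ M : ℝ, ∀ U, |h U| ≤ M) →
      IsGaugeInvariant h → DependsOn h {e : Edge 4 (2 * S + 1) | ¬ ((e.1 0 - s).val = 0 ∧ e.2 ≠ 0)} →
      ∫ U, (condExp (cylinderEvents {e : Edge 4 (2 * S + 1) | (e.1 0 - s).val = 0 ∧ e.2 ≠ 0}) μ h U -
          ∫ V, h V ∂μ) ^ 2 ∂μ ≤ θ₁ * ∫ U, (h U - ∫ V, h V ∂μ) ^ 2 ∂μ) →
    (∀ h : GaugeConfig 4 (2 * S + 1) G → ℝ, Measurable h → (∃ M : ℝ, ∀ U, |h U| ≤ M) →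
      IsGaugeInvariant h → DependsOn h {e : Edge 4 (2 * S + 1) | ℓ ≤ (e.1 0 - s).val} →
      ∫ U, (condExp (cylinderEvents {e : Edge 4 (2 * S + 1) |
              ((e.1 0 - s).val = 0 ∨ (e.1 0 - s).val = ℓ - 1) ∧ e.2 ≠ 0}) μ h U -
            condExp (cylinderEvents {e : Edge 4 (2 * S + 1) | (e.1 0 - s).val = 0 ∧ e.2 ≠ 0}) μ h U) ^ 2 ∂μ ≤
        θ₂ * ∫ U, (h U -
            condExp (cylinderEvents {e : Edge 4 (2 * S + 1) | (e.1 0 - s).val = 0 ∧ e.2 ≠ 0}) μ h U) ^ 2 ∂μ) →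
    ∀ h : GaugeConfig 4 (2 * S + 1) G → ℝ, Measurable h → (∃ M : ℝ, ∀ U, |h U| ≤ M) →
      IsGaugeInvariant h → DependsOn h {e : Edge 4 (2 * S + 1) | ℓ ≤ (e.1 0 - s).val} →
    ∫ U, (condExp (cylinderEvents {e : Edge 4 (2 * S + 1) |
            ((e.1 0 - s).val = 0 ∨ (e.1 0 - s).val = ℓ - 1) ∧ e.2 ≠ 0}) μ h U - ∫ V, h V ∂μ) ^ 2 ∂μ ≤
      (θ₁ + θ₂ - θ₁ * θ₂) * ∫ U, (h U - ∫ V, h V ∂μ) ^ 2 ∂μ :=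
  Summit.QuantumFields.YangMills.Theorems.PoincareToGap.stub_projectionBound_glue

/-! ### §1e Reshape 4 (lead c3, 2026-08-17): PB1 ⟸ T1 (time shift) ∧ SW (SMOOTH-WITNESS, hypothesis-free) ∧ L1 ∧ L2

Write `X_s := {e | (e.1 0 - s).val = 0 ∧ e.2 ≠ 0}` (spatial links based at time `s`), `O_s := X_sᶜ` (all other links),
`P_D := condExp (cylinderEvents D) μ`, `dir_s f := Σ_{e ∈ X_s} ∫ (slope_e f)² dμ` (the crux's Dirichlet form moved to slice `s`).
PB1 asks `Var(P_{X_s} h) ≤ θ₁ Var h` for gauge-invariant bounded `h` reading `O_s`.  By the landed duality H1a (with the two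
link sets EXCHANGED) this is equivalent to ONE-SLICE RETENTION `(1 − θ₁) Var F ≤ ‖F − P_{O_s} F‖²` for gauge-invariant bounded
`F` reading `X_s` (L2).  Retention follows from the hypothesis at slice `s` (T1) as soon as every such `F` splits as
`F = F₁ + (F − F₁)` with `F₁` ADMISSIBLE for the hypothesis and `dir_s F₁ / β + ‖F − F₁‖² ≤ C ‖F − P_{O_s} F‖²` (SW): then
`Var F ≤ 2 Var F₁ + 2 ‖F − F₁‖² ≤ 2κ dir_s F₁ + 2‖F − F₁‖² ≤ 2 max(κβ, 1) · C · ‖F − P_{O_s} F‖²` (L1).  SW is the typed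
form of the census's SMOOTH-WITNESS: rough (UV) `F` take `F₁ = const` (they lose an `O(1)` fraction of their variance when the
slice is resampled given its neighbours); smooth `F` take `F₁ = F` (conditional Cramér–Rao: the two-sided one-step law has
Fisher information `O(β)`, so it dissipates `≳ dir F/β`); the content is the interpolation with VOLUME-FREE `C` — exactly the
slow-mode regularity of Wilson's one-step kernel (NOTES §8.2), now WITHOUT the Poincaré hypothesis inside it.  Gaussian
calibration: `C = O(1)` uniformly in the mass (normal modes).  Natural witness: `F₁ :=` the DLR-kernel version of the heat-bath
average `P_{X_s} P_{O_s} F` (gauge-invariant and link-Lipschitz by Haar bi-invariance and the one-link perturbation bound,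
`‖F − F₁‖² ≤ ⟨F, (1 − P_{X_s}P_{O_s})F⟩ = ‖F − P_{O_s}F‖²`), for which SW reduces to the heat-bath smoothing bound
`dir_s(P_{X_s} P_{O_s} F) ≤ C β ‖F − P_{O_s} F‖²`.  NUMERICS (kit j026162, NOTES §10.6; 4d SU(2), `L = 6, 8, 10`, `β = 2.3–2.7`):
no falsifier — the slowest one-slice modes (smeared torelons, two-sided loss 15–35 %) have `dir/(β‖F − P_{O_s}F‖²) ∈ [0.86, 1.27]`,
flat in `L`; over 24 observables × 9 lattices the better trivial witness costs at most `2.9 ×` the loss. -/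

/-- T1 `stub_sliceHypothesis_timeShift` — **the slice Poincaré hypothesis holds at every time slice** (LANDED p155704,
`Theorems/ConvexGribovBodyPoincareToGapTimeShift.lean`; template: `stub_sliceCovSum_le` / `stub_axisSwap_transport`).  On one torus, IF the crux hypothesis holds at this `S`
(verbatim body: Poincaré(κ) for gauge-invariant link-Lipschitz `f` reading the time-ZERO spatial links, Dirichlet form over
`X_0`), THEN for every `s : ZMod (2S+1)` the same inequality holds for gauge-invariant link-Lipschitz `f` reading the time-`s`
spatial links, with the Dirichlet form over `X_s`.  Proof: given such `f`, `g := f ∘ T⁰_{−s}`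
(`T⁰_v := torusConfigShift (Pi.single 0 v)`, `(T⁰_v U)(x,k) = U(x − v e₀, k)`) reads `X_0`, is gauge-invariant (shifts
commute with gauge transformations up to shifting the gauge function) and link-Lipschitz (re-index the edge sum); the
hypothesis gives `Var g ≤ κ dir_0 g`; `Var g = Var f` by `wilsonMeasure_map_torusConfigShift`; and for `e ∈ X_0`,
`T(update U e k) = update (T U) ê k` with `ê = (e.1 − (−s) e₀, e.2) ∈ X_s`, `(T U) ê = U e`, so the difference functions
`k ↦ g(update U e k) − g U` and `k ↦ f(update (TU) ê k) − f(TU)` coincide, `slope_e g (U) = slope_ê f (T U)`, and integrating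
with translation invariance `dir_0 g = dir_s f` (the map `e ↦ ê` is a bijection `X_0 → X_s`). -/
theorem stub_sliceHypothesis_timeShift :
    ∀ (G : Type) [Group G] [TopologicalSpace G] [IsTopologicalGroup G] [CompactSpace G]
      [MeasurableSpace G] [BorelSpace G] (r : LatticeRep G) (β κ : ℝ) (S : ℕ),
    (∀ f : GaugeConfig 4 (2 * S + 1) G → ℝ, IsGaugeInvariant f →
      (∀ U V : GaugeConfig 4 (2 * S + 1) G,
        (∀ e : Edge 4 (2 * S + 1), e.1 0 = 0 → e.2 ≠ 0 → U e = V e) → f U = f V) →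
      (∃ K : ℝ, ∀ U V : GaugeConfig 4 (2 * S + 1) G,
        |f U - f V| ≤ K * ∑ e, Real.sqrt (∑ a, ∑ b, ‖(r.ρ (U e) - r.ρ (V e)) a b‖ ^ 2)) →
      ∫ U, (f U - ∫ V, f V ∂(wilsonMeasure r.ρ β : Measure (GaugeConfig 4 (2 * S + 1) G))) ^ 2
          ∂(wilsonMeasure r.ρ β : Measure (GaugeConfig 4 (2 * S + 1) G)) ≤
        κ * ∑ e : Edge 4 (2 * S + 1), (if e.1 0 = 0 ∧ e.2 ≠ 0 then
          ∫ U, (Filter.limsup (fun g : G => |f (Function.update U e g) - f U| /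
              Real.sqrt (∑ a, ∑ b, ‖(r.ρ g - r.ρ (U e)) a b‖ ^ 2)) (𝓝[≠] (U e))) ^ 2
            ∂(wilsonMeasure r.ρ β : Measure (GaugeConfig 4 (2 * S + 1) G)) else 0)) →
    ∀ μ : Measure (GaugeConfig 4 (2 * S + 1) G),
      μ = (wilsonMeasure r.ρ β : Measure (GaugeConfig 4 (2 * S + 1) G)) →
    ∀ (s : ZMod (2 * S + 1)) (f : GaugeConfig 4 (2 * S + 1) G → ℝ), IsGaugeInvariant f →
      (∀ U V : GaugeConfig 4 (2 * S + 1) G,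
        (∀ e : Edge 4 (2 * S + 1), (e.1 0 - s).val = 0 → e.2 ≠ 0 → U e = V e) → f U = f V) →
      (∃ K : ℝ, ∀ U V : GaugeConfig 4 (2 * S + 1) G,
        |f U - f V| ≤ K * ∑ e, Real.sqrt (∑ a, ∑ b, ‖(r.ρ (U e) - r.ρ (V e)) a b‖ ^ 2)) →
      ∫ U, (f U - ∫ V, f V ∂μ) ^ 2 ∂μ ≤
        κ * ∑ e : Edge 4 (2 * S + 1), (if (e.1 0 - s).val = 0 ∧ e.2 ≠ 0 then
          ∫ U, (Filter.limsup (fun g : G => |f (Function.update U e g) - f U| /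
              Real.sqrt (∑ a, ∑ b, ‖(r.ρ g - r.ρ (U e)) a b‖ ^ 2)) (𝓝[≠] (U e))) ^ 2 ∂μ else 0) :=
  Summit.QuantumFields.YangMills.Theorems.PoincareToGap.stub_sliceHypothesis_timeShift

/-- SW `stub_smoothWitness` — **OPEN HEART (hypothesis-free, `β`-local): SMOOTH-WITNESS in K-functional form.**  For
every compact simple `G`, faithful unitary `r` and `β > 0` there are `C > 0` and `S₁` such that on every torus `S ≥ S₁`,
every time slice `s` and every bounded measurable gauge-invariant `F` reading only the spatial links `X_s` of that slice,
there is an ADMISSIBLE witness `F₁` (measurable, bounded, gauge-invariant, reading only `X_s` in the hypothesis' sense,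
link-Lipschitz) with  `dir_s(F₁)/β + ∫ (F − F₁)² dμ ≤ C · ∫ (F − E_μ[F | X_sᶜ])² dμ`:  the variance a one-slice function
loses when its slice is resampled given all other links (two-sided heat bath) controls BOTH its distance to a smooth
admissible function AND that function's Dirichlet energy at scale `β`.  Rough `F`: `F₁ = ∫F`; smooth `F`: `F₁ = F` and the
claim is the conditional Cramér–Rao lower bound `E Var(F | X_sᶜ) ≳ dir_s F/β` (Fisher information of the explicit two-sided
one-step Gibbs law is `O(β)`); in general `F₁ :=` the kernel version of `P_{X_s}P_{X_sᶜ}F` and the claim is the heat-bath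
smoothing bound `dir_s(P_{X_s}P_{X_sᶜ}F) ≤ Cβ‖F − P_{X_sᶜ}F‖²` (volume-free `C` = slow-mode regularity; refutable only by a
slow mode of the one-step chain invisible to every smooth slice function).  With the hypothesis (`Var ≤ κ dir_s` on admissible
functions, T1) it gives one-slice retention (L1) and hence PB1 (L2). -/
theorem stub_smoothWitness :
    ∀ (G : Type) [Group G] [TopologicalSpace G] [IsTopologicalGroup G] [CompactSpace G]
      [MeasurableSpace G] [BorelSpace G], IsCompactSimpleLieGroup G →
    ∀ (r : LatticeRep G) (β : ℝ), 0 < β →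
    ∃ C : ℝ, 0 < C ∧ ∃ S₁ : ℕ, ∀ S : ℕ, S₁ ≤ S →
      ∀ μ : Measure (GaugeConfig 4 (2 * S + 1) G),
        μ = (wilsonMeasure r.ρ β : Measure (GaugeConfig 4 (2 * S + 1) G)) →
      ∀ (s : ZMod (2 * S + 1)) (F : GaugeConfig 4 (2 * S + 1) G → ℝ), Measurable F →
        (∃ M : ℝ, ∀ U, |F U| ≤ M) → IsGaugeInvariant F →
        DependsOn F {e : Edge 4 (2 * S + 1) | (e.1 0 - s).val = 0 ∧ e.2 ≠ 0} →
      ∃ F₁ : GaugeConfig 4 (2 * S + 1) G → ℝ, Measurable F₁ ∧ (∃ M : ℝ, ∀ U, |F₁ U| ≤ M) ∧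
        IsGaugeInvariant F₁ ∧
        (∀ U V : GaugeConfig 4 (2 * S + 1) G,
          (∀ e : Edge 4 (2 * S + 1), (e.1 0 - s).val = 0 → e.2 ≠ 0 → U e = V e) → F₁ U = F₁ V) ∧
        (∃ K : ℝ, ∀ U V : GaugeConfig 4 (2 * S + 1) G,
          |F₁ U - F₁ V| ≤ K * ∑ e, Real.sqrt (∑ a, ∑ b, ‖(r.ρ (U e) - r.ρ (V e)) a b‖ ^ 2)) ∧
        (∑ e : Edge 4 (2 * S + 1), (if (e.1 0 - s).val = 0 ∧ e.2 ≠ 0 then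
            ∫ U, (Filter.limsup (fun g : G => |F₁ (Function.update U e g) - F₁ U| /
                Real.sqrt (∑ a, ∑ b, ‖(r.ρ g - r.ρ (U e)) a b‖ ^ 2)) (𝓝[≠] (U e))) ^ 2 ∂μ else 0)) / β +
          ∫ U, (F U - F₁ U) ^ 2 ∂μ ≤
        C * ∫ U, (F U - condExp (cylinderEvents
            {e : Edge 4 (2 * S + 1) | ¬ ((e.1 0 - s).val = 0 ∧ e.2 ≠ 0)}) μ F U) ^ 2 ∂μ := by
  sorry

/-- L1 `stub_retention_of_smoothWitness` — **hypothesis at slice `s` ∧ smooth witness ⇒ one-slice retention**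
(LANDED p156157, `Theorems/ConvexGribovBodyPoincareToGapRetentionOfSmoothWitness.lean`; pure `L²` algebra on the probability space `(GaugeConfig, μ)`).  On one torus and one slice `s`: if
every gauge-invariant link-Lipschitz `f` reading `X_s` has `Var f ≤ κ dir_s f` (T1's conclusion at `s`), and every bounded
measurable gauge-invariant `F` reading `X_s` has a witness `F₁` as in SW with constant `C`, then every such `F` satisfies
`Var F ≤ 2 · max(κβ, 1) · C · ∫ (F − E_μ[F | X_sᶜ])²`.  Proof: `Var F ≤ 2 Var F₁ + 2 Var(F − F₁)` (`(x+y)² ≤ 2x² + 2y²`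
under the integral, with the means split accordingly), `Var F₁ ≤ κ dir_s F₁ = (κβ)(dir_s F₁/β) ≤ max(κβ,1) dir_s F₁/β`
(`dir_s F₁ ≥ 0`: a sum of integrals of squares; `β > 0`), `Var(F − F₁) ≤ ∫ (F − F₁)² ≤ max(κβ,1) ∫ (F − F₁)²`, and SW.
All functions are bounded measurable, so every integral exists (`MemLp.of_bound`). -/
theorem stub_retention_of_smoothWitness :
    ∀ (G : Type) [Group G] [TopologicalSpace G] [IsTopologicalGroup G] [CompactSpace G]
      [MeasurableSpace G] [BorelSpace G] (r : LatticeRep G) (β κ C : ℝ), 0 < β → ∀ (S : ℕ)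
      (μ : Measure (GaugeConfig 4 (2 * S + 1) G)),
      μ = (wilsonMeasure r.ρ β : Measure (GaugeConfig 4 (2 * S + 1) G)) →
    ∀ s : ZMod (2 * S + 1),
    (∀ f : GaugeConfig 4 (2 * S + 1) G → ℝ, IsGaugeInvariant f →
      (∀ U V : GaugeConfig 4 (2 * S + 1) G,
        (∀ e : Edge 4 (2 * S + 1), (e.1 0 - s).val = 0 → e.2 ≠ 0 → U e = V e) → f U = f V) →
      (∃ K : ℝ, ∀ U V : GaugeConfig 4 (2 * S + 1) G,
        |f U - f V| ≤ K * ∑ e, Real.sqrt (∑ a, ∑ b, ‖(r.ρ (U e) - r.ρ (V e)) a b‖ ^ 2)) →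
      ∫ U, (f U - ∫ V, f V ∂μ) ^ 2 ∂μ ≤
        κ * ∑ e : Edge 4 (2 * S + 1), (if (e.1 0 - s).val = 0 ∧ e.2 ≠ 0 then
          ∫ U, (Filter.limsup (fun g : G => |f (Function.update U e g) - f U| /
              Real.sqrt (∑ a, ∑ b, ‖(r.ρ g - r.ρ (U e)) a b‖ ^ 2)) (𝓝[≠] (U e))) ^ 2 ∂μ else 0)) →
    (∀ F : GaugeConfig 4 (2 * S + 1) G → ℝ, Measurable F → (∃ M : ℝ, ∀ U, |F U| ≤ M) →
      IsGaugeInvariant F → DependsOn F {e : Edge 4 (2 * S + 1) | (e.1 0 - s).val = 0 ∧ e.2 ≠ 0} →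
      ∃ F₁ : GaugeConfig 4 (2 * S + 1) G → ℝ, Measurable F₁ ∧ (∃ M : ℝ, ∀ U, |F₁ U| ≤ M) ∧
        IsGaugeInvariant F₁ ∧
        (∀ U V : GaugeConfig 4 (2 * S + 1) G,
          (∀ e : Edge 4 (2 * S + 1), (e.1 0 - s).val = 0 → e.2 ≠ 0 → U e = V e) → F₁ U = F₁ V) ∧
        (∃ K : ℝ, ∀ U V : GaugeConfig 4 (2 * S + 1) G,
          |F₁ U - F₁ V| ≤ K * ∑ e, Real.sqrt (∑ a, ∑ b, ‖(r.ρ (U e) - r.ρ (V e)) a b‖ ^ 2)) ∧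
        (∑ e : Edge 4 (2 * S + 1), (if (e.1 0 - s).val = 0 ∧ e.2 ≠ 0 then
            ∫ U, (Filter.limsup (fun g : G => |F₁ (Function.update U e g) - F₁ U| /
                Real.sqrt (∑ a, ∑ b, ‖(r.ρ g - r.ρ (U e)) a b‖ ^ 2)) (𝓝[≠] (U e))) ^ 2 ∂μ else 0)) / β +
          ∫ U, (F U - F₁ U) ^ 2 ∂μ ≤
        C * ∫ U, (F U - condExp (cylinderEvents
            {e : Edge 4 (2 * S + 1) | ¬ ((e.1 0 - s).val = 0 ∧ e.2 ≠ 0)}) μ F U) ^ 2 ∂μ) →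
    ∀ F : GaugeConfig 4 (2 * S + 1) G → ℝ, Measurable F → (∃ M : ℝ, ∀ U, |F U| ≤ M) →
      IsGaugeInvariant F → DependsOn F {e : Edge 4 (2 * S + 1) | (e.1 0 - s).val = 0 ∧ e.2 ≠ 0} →
    ∫ U, (F U - ∫ V, F V ∂μ) ^ 2 ∂μ ≤
      2 * max (κ * β) 1 * C * ∫ U, (F U - condExp (cylinderEvents
          {e : Edge 4 (2 * S + 1) | ¬ ((e.1 0 - s).val = 0 ∧ e.2 ≠ 0)}) μ F U) ^ 2 ∂μ :=
  Summit.QuantumFields.YangMills.Theorems.PoincareToGap.stub_retention_of_smoothWitness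

/-- L2 `stub_oneSliceProjectionBound_of_retention` — **one-slice retention ⇒ the one-slice projection bound**
(LANDED p156414, `Theorems/ConvexGribovBodyPoincareToGapProjectionOfRetention.lean`; the landed duality H1a
`stub_retention_of_projectionBound` with the link sets EXCHANGED, framed by Pythagoras).  On one torus and one slice `s`, with `X = X_s`, `O = X_sᶜ`, `0 ≤ θ`: if every bounded measurable
gauge-invariant `F` reading `X` keeps the fraction `1 − θ` of its variance under `P_O`, `(1 − θ) Var F ≤ ‖F − P_O F‖²`,
then every bounded measurable gauge-invariant `h` reading `O` has `Var(P_X h) ≤ θ Var h`.  Proof: Pythagoras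
(`TwoBlock.integral_sub_condExp_sq` for `F − ∫F`, `P_O(F − c) = P_O F − c`) turns the premise into the projection bound
`Var(P_O F) ≤ θ Var F` for `F` reading `X`; H1a with `(E, O) := (O, X)` gives retention `(1 − θ) Var h ≤ ‖h − P_X h‖²` for
`h` reading `O`; Pythagoras again gives `Var(P_X h) = Var h − ‖h − P_X h‖² ≤ θ Var h`. -/
theorem stub_oneSliceProjectionBound_of_retention :
    ∀ (G : Type) [Group G] [TopologicalSpace G] [IsTopologicalGroup G] [CompactSpace G]
      [MeasurableSpace G] [BorelSpace G] (r : LatticeRep G) (β : ℝ) (S : ℕ)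
      (μ : Measure (GaugeConfig 4 (2 * S + 1) G)),
      μ = (wilsonMeasure r.ρ β : Measure (GaugeConfig 4 (2 * S + 1) G)) →
    ∀ (s : ZMod (2 * S + 1)) (θ : ℝ), 0 ≤ θ →
    (∀ F : GaugeConfig 4 (2 * S + 1) G → ℝ, Measurable F → (∃ M : ℝ, ∀ U, |F U| ≤ M) →
      IsGaugeInvariant F → DependsOn F {e : Edge 4 (2 * S + 1) | (e.1 0 - s).val = 0 ∧ e.2 ≠ 0} →
      (1 - θ) * ∫ U, (F U - ∫ V, F V ∂μ) ^ 2 ∂μ ≤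
        ∫ U, (F U - condExp (cylinderEvents
          {e : Edge 4 (2 * S + 1) | ¬ ((e.1 0 - s).val = 0 ∧ e.2 ≠ 0)}) μ F U) ^ 2 ∂μ) →
    ∀ h : GaugeConfig 4 (2 * S + 1) G → ℝ, Measurable h → (∃ M : ℝ, ∀ U, |h U| ≤ M) →
      IsGaugeInvariant h → DependsOn h {e : Edge 4 (2 * S + 1) | ¬ ((e.1 0 - s).val = 0 ∧ e.2 ≠ 0)} →
    ∫ U, (condExp (cylinderEvents {e : Edge 4 (2 * S + 1) | (e.1 0 - s).val = 0 ∧ e.2 ≠ 0}) μ h U -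
        ∫ V, h V ∂μ) ^ 2 ∂μ ≤ θ * ∫ U, (h U - ∫ V, h V ∂μ) ^ 2 ∂μ :=
  Summit.QuantumFields.YangMills.Theorems.PoincareToGap.stub_oneSliceProjectionBound_of_retention

/-- **PB1 (one-slice projection bound) from the slice Poincaré hypothesis, MODULO the smooth-witness heart SW**
(reshape 4; the former registered stub `stub_oneSliceProjectionBound_of_slicePoincare`, signature unchanged; the composition
`oneSliceProjectionBound_of_smoothWitness` HYP ∧ SW ⇒ PB1 is LANDED, p156749,
`Theorems/ConvexGribovBodyPoincareToGapProjectionBoundOfSmoothWitness.lean`).  SW gives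
`C, S₁`; put `K := max (2 max(κβ,1) C) 1 ≥ 1` and `θ₁ := 1 − 1/K ∈ [0, 1)`; for `S ≥ max S₀ S₁` and any slice `s`, T1 moves
the hypothesis to slice `s`, L1 gives `Var F ≤ K ‖F − P_{X_sᶜ} F‖²` for one-slice `F`, i.e. retention with `1 − θ₁ = 1/K`,
and L2 turns it into the projection bound with `θ₁`. -/
theorem oneSliceProjectionBound_of_slicePoincare :
    ∀ (G : Type) [Group G] [TopologicalSpace G] [IsTopologicalGroup G] [CompactSpace G]
      [MeasurableSpace G] [BorelSpace G], IsCompactSimpleLieGroup G →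
    ∀ (r : LatticeRep G) (β : ℝ), 0 < β → ∀ κ : ℝ, 0 < κ → ∀ S₀ : ℕ,
    (∀ S : ℕ, S₀ ≤ S → ∀ f : GaugeConfig 4 (2 * S + 1) G → ℝ, IsGaugeInvariant f →
      (∀ U V : GaugeConfig 4 (2 * S + 1) G,
        (∀ e : Edge 4 (2 * S + 1), e.1 0 = 0 → e.2 ≠ 0 → U e = V e) → f U = f V) →
      (∃ K : ℝ, ∀ U V : GaugeConfig 4 (2 * S + 1) G,
        |f U - f V| ≤ K * ∑ e, Real.sqrt (∑ a, ∑ b, ‖(r.ρ (U e) - r.ρ (V e)) a b‖ ^ 2)) →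
      ∫ U, (f U - ∫ V, f V ∂(wilsonMeasure r.ρ β : Measure (GaugeConfig 4 (2 * S + 1) G))) ^ 2
          ∂(wilsonMeasure r.ρ β : Measure (GaugeConfig 4 (2 * S + 1) G)) ≤
        κ * ∑ e : Edge 4 (2 * S + 1), (if e.1 0 = 0 ∧ e.2 ≠ 0 then
          ∫ U, (Filter.limsup (fun g : G => |f (Function.update U e g) - f U| /
              Real.sqrt (∑ a, ∑ b, ‖(r.ρ g - r.ρ (U e)) a b‖ ^ 2)) (𝓝[≠] (U e))) ^ 2
            ∂(wilsonMeasure r.ρ β : Measure (GaugeConfig 4 (2 * S + 1) G)) else 0)) →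
    ∃ θ₁ : ℝ, 0 ≤ θ₁ ∧ θ₁ < 1 ∧ ∃ S₁ : ℕ, ∀ S : ℕ, S₁ ≤ S →
      ∀ μ : Measure (GaugeConfig 4 (2 * S + 1) G),
        μ = (wilsonMeasure r.ρ β : Measure (GaugeConfig 4 (2 * S + 1) G)) →
      ∀ (s : ZMod (2 * S + 1)) (h : GaugeConfig 4 (2 * S + 1) G → ℝ), Measurable h →
        (∃ M : ℝ, ∀ U, |h U| ≤ M) → IsGaugeInvariant h →
        DependsOn h {e : Edge 4 (2 * S + 1) | ¬ ((e.1 0 - s).val = 0 ∧ e.2 ≠ 0)} →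
      ∫ U, (condExp (cylinderEvents {e : Edge 4 (2 * S + 1) | (e.1 0 - s).val = 0 ∧ e.2 ≠ 0}) μ h U -
          ∫ V, h V ∂μ) ^ 2 ∂μ ≤ θ₁ * ∫ U, (h U - ∫ V, h V ∂μ) ^ 2 ∂μ := by
  intro G _ _ _ _ _ _ hG r β hβ κ _hκ S₀ hP
  exact Summit.QuantumFields.YangMills.Theorems.PoincareToGap.oneSliceProjectionBound_of_smoothWitness G r β hβ κ S₀
    hP (stub_smoothWitness G hG r β hβ)

/-- `stub_conditionalProjectionBound_of_slicePoincare` — **OPEN CORE 2 (PB2, conditional; knot K-b; held by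
the lead)**: the crux's hypothesis implies that on all large tori, for every arc of `ℓ` slices (`3 ≤ ℓ ≤ 2S−2`)
from `s` and every gauge-invariant bounded `h` reading only links outside the arc, the far end slice adds at most
the fraction `θ₂ < 1` of the RESIDUAL variance given the near end slice:
`‖E[h | X_s ∪ X_u] − E[h | X_s]‖² ≤ θ₂ ‖h − E[h | X_s]‖²` (`u = s + ℓ − 1`, spatial links).  This is a projection bound
for ONE slice CONDITIONALLY on a far slice — intrinsic to the torus (the complement of an arc has two boundary
slices; antipodal cuts, partial maximal correlations and one-sided peeling all reduce to it).  Gaussian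
calibration: `θ₂ = θ₁` (conditioning only shifts means). -/
theorem stub_conditionalProjectionBound_of_slicePoincare :
    ∀ (G : Type) [Group G] [TopologicalSpace G] [IsTopologicalGroup G] [CompactSpace G]
      [MeasurableSpace G] [BorelSpace G], IsCompactSimpleLieGroup G →
    ∀ (r : LatticeRep G) (β : ℝ), 0 < β → ∀ κ : ℝ, 0 < κ → ∀ S₀ : ℕ,
    (∀ S : ℕ, S₀ ≤ S → ∀ f : GaugeConfig 4 (2 * S + 1) G → ℝ, IsGaugeInvariant f →
      (∀ U V : GaugeConfig 4 (2 * S + 1) G,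
        (∀ e : Edge 4 (2 * S + 1), e.1 0 = 0 → e.2 ≠ 0 → U e = V e) → f U = f V) →
      (∃ K : ℝ, ∀ U V : GaugeConfig 4 (2 * S + 1) G,
        |f U - f V| ≤ K * ∑ e, Real.sqrt (∑ a, ∑ b, ‖(r.ρ (U e) - r.ρ (V e)) a b‖ ^ 2)) →
      ∫ U, (f U - ∫ V, f V ∂(wilsonMeasure r.ρ β : Measure (GaugeConfig 4 (2 * S + 1) G))) ^ 2
          ∂(wilsonMeasure r.ρ β : Measure (GaugeConfig 4 (2 * S + 1) G)) ≤
        κ * ∑ e : Edge 4 (2 * S + 1), (if e.1 0 = 0 ∧ e.2 ≠ 0 then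
          ∫ U, (Filter.limsup (fun g : G => |f (Function.update U e g) - f U| /
              Real.sqrt (∑ a, ∑ b, ‖(r.ρ g - r.ρ (U e)) a b‖ ^ 2)) (𝓝[≠] (U e))) ^ 2
            ∂(wilsonMeasure r.ρ β : Measure (GaugeConfig 4 (2 * S + 1) G)) else 0)) →
    ∃ θ₂ : ℝ, 0 ≤ θ₂ ∧ θ₂ < 1 ∧ ∃ S₁ : ℕ, ∀ S : ℕ, S₁ ≤ S →
      ∀ μ : Measure (GaugeConfig 4 (2 * S + 1) G),
        μ = (wilsonMeasure r.ρ β : Measure (GaugeConfig 4 (2 * S + 1) G)) →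
      ∀ (s : ZMod (2 * S + 1)) (ℓ : ℕ), 3 ≤ ℓ → ℓ + 3 ≤ 2 * S + 1 →
      ∀ h : GaugeConfig 4 (2 * S + 1) G → ℝ, Measurable h → (∃ M : ℝ, ∀ U, |h U| ≤ M) →
        IsGaugeInvariant h → DependsOn h {e : Edge 4 (2 * S + 1) | ℓ ≤ (e.1 0 - s).val} →
      ∫ U, (condExp (cylinderEvents {e : Edge 4 (2 * S + 1) |
              ((e.1 0 - s).val = 0 ∨ (e.1 0 - s).val = ℓ - 1) ∧ e.2 ≠ 0}) μ h U -
            condExp (cylinderEvents {e : Edge 4 (2 * S + 1) | (e.1 0 - s).val = 0 ∧ e.2 ≠ 0}) μ h U) ^ 2 ∂μ ≤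
        θ₂ * ∫ U, (h U -
            condExp (cylinderEvents {e : Edge 4 (2 * S + 1) | (e.1 0 - s).val = 0 ∧ e.2 ≠ 0}) μ h U) ^ 2 ∂μ := by
  sorry

/-! ### §1b Composition stubs (hypothesis-free interfaces; C2 LANDED p122459, C1 to land) -/

/-- C1 `stub_twoTimeRetention_of_projectionBounds` — **PB1 ∧ PB2 ⇒ two-time arc retention** with
`ε = (1 − θ₁)(1 − θ₂)` (hypothesis-free composition of the glue G1 p106765 and the duality H1a p104460; file
`work/stubs/RetentionOfProjectionBounds.lean`, 8-line proof, lands as soon as the farm has built the Duality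
module).  Stated WITHOUT any Poincaré hypothesis so that a re-typed crux can consume it directly. -/
theorem stub_twoTimeRetention_of_projectionBounds :
    ∀ (G : Type) [Group G] [TopologicalSpace G] [IsTopologicalGroup G] [CompactSpace G]
      [MeasurableSpace G] [BorelSpace G] (r : LatticeRep G) (β θ₁ θ₂ : ℝ),
      0 ≤ θ₁ → θ₁ < 1 → 0 ≤ θ₂ → θ₂ < 1 → ∀ S₁ : ℕ,
    (∀ S : ℕ, S₁ ≤ S →
      ∀ μ : Measure (GaugeConfig 4 (2 * S + 1) G),
        μ = (wilsonMeasure r.ρ β : Measure (GaugeConfig 4 (2 * S + 1) G)) →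
      ∀ (s : ZMod (2 * S + 1)) (h : GaugeConfig 4 (2 * S + 1) G → ℝ), Measurable h →
        (∃ M : ℝ, ∀ U, |h U| ≤ M) → IsGaugeInvariant h →
        DependsOn h {e : Edge 4 (2 * S + 1) | ¬ ((e.1 0 - s).val = 0 ∧ e.2 ≠ 0)} →
      ∫ U, (condExp (cylinderEvents {e : Edge 4 (2 * S + 1) | (e.1 0 - s).val = 0 ∧ e.2 ≠ 0}) μ h U -
          ∫ V, h V ∂μ) ^ 2 ∂μ ≤ θ₁ * ∫ U, (h U - ∫ V, h V ∂μ) ^ 2 ∂μ) →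
    (∀ S : ℕ, S₁ ≤ S →
      ∀ μ : Measure (GaugeConfig 4 (2 * S + 1) G),
        μ = (wilsonMeasure r.ρ β : Measure (GaugeConfig 4 (2 * S + 1) G)) →
      ∀ (s : ZMod (2 * S + 1)) (ℓ : ℕ), 3 ≤ ℓ → ℓ + 3 ≤ 2 * S + 1 →
      ∀ h : GaugeConfig 4 (2 * S + 1) G → ℝ, Measurable h → (∃ M : ℝ, ∀ U, |h U| ≤ M) →
        IsGaugeInvariant h → DependsOn h {e : Edge 4 (2 * S + 1) | ℓ ≤ (e.1 0 - s).val} →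
      ∫ U, (condExp (cylinderEvents {e : Edge 4 (2 * S + 1) |
              ((e.1 0 - s).val = 0 ∨ (e.1 0 - s).val = ℓ - 1) ∧ e.2 ≠ 0}) μ h U -
            condExp (cylinderEvents {e : Edge 4 (2 * S + 1) | (e.1 0 - s).val = 0 ∧ e.2 ≠ 0}) μ h U) ^ 2 ∂μ ≤
        θ₂ * ∫ U, (h U -
            condExp (cylinderEvents {e : Edge 4 (2 * S + 1) | (e.1 0 - s).val = 0 ∧ e.2 ≠ 0}) μ h U) ^ 2 ∂μ) →
    ∀ S : ℕ, S₁ ≤ S →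
      ∀ μ : Measure (GaugeConfig 4 (2 * S + 1) G),
        μ = (wilsonMeasure r.ρ β : Measure (GaugeConfig 4 (2 * S + 1) G)) →
      ∀ (s : ZMod (2 * S + 1)) (ℓ : ℕ), 3 ≤ ℓ → ℓ + 3 ≤ 2 * S + 1 →
      ∀ F : GaugeConfig 4 (2 * S + 1) G → ℝ, Measurable F → (∃ M : ℝ, ∀ U, |F U| ≤ M) →
        IsGaugeInvariant F →
        DependsOn F {e : Edge 4 (2 * S + 1) |
          ((e.1 0 - s).val = 0 ∨ (e.1 0 - s).val = ℓ - 1) ∧ e.2 ≠ 0} →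
      (1 - θ₁) * (1 - θ₂) * ∫ U, (F U - ∫ V, F V ∂μ) ^ 2 ∂μ ≤
        ∫ U, (F U - condExp (cylinderEvents {e : Edge 4 (2 * S + 1) | ℓ ≤ (e.1 0 - s).val}) μ F U) ^ 2 ∂μ := by
  intro G _ _ _ _ _ _ r β θ₁ θ₂ h10 _h11 h20 h21 S₁ hPB1 hPB2 S hS μ hμ s ℓ h3 hℓ F hFm hFb hFi hFd
  have hglue := stub_projectionBound_glue G r β S μ hμ s ℓ θ₁ θ₂ h10 h20 h21.le (by omega)
    (fun h' hm' hb' hi' hd' => hPB1 S hS μ hμ s h' hm' hb' hi' hd') (hPB2 S hS μ hμ s ℓ h3 hℓ)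
  have hret := stub_retention_of_projectionBound G r β S μ hμ _ _ (θ₁ + θ₂ - θ₁ * θ₂) (by nlinarith)
    hglue F hFm hFb hFi hFd
  have hε : (1 - θ₁) * (1 - θ₂) = 1 - (θ₁ + θ₂ - θ₁ * θ₂) := by ring
  rw [hε]
  exact hret

/-- C2 `stub_gapAt_of_twoTimeRetention` — **two-time arc retention ⇒ the crux's clustering body**
(hypothesis-free composition P3 ∘ P2 ∘ P1; LANDED p122459,
`Theorems/ConvexGribovBodyPoincareToGapRetentionToGap.lean`). -/
theorem stub_gapAt_of_twoTimeRetention :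
    ∀ (G : Type) [Group G] [TopologicalSpace G] [IsTopologicalGroup G] [CompactSpace G]
      [MeasurableSpace G] [BorelSpace G] (r : LatticeRep G) (β ε : ℝ), 0 < ε → ε ≤ 1 → ∀ S₁ : ℕ,
    (∀ S : ℕ, S₁ ≤ S → ∀ μ : Measure (GaugeConfig 4 (2 * S + 1) G),
      μ = (wilsonMeasure r.ρ β : Measure (GaugeConfig 4 (2 * S + 1) G)) →
      ∀ (s : ZMod (2 * S + 1)) (ℓ : ℕ), 3 ≤ ℓ → ℓ + 3 ≤ 2 * S + 1 →
      ∀ F : GaugeConfig 4 (2 * S + 1) G → ℝ, Measurable F → (∃ M : ℝ, ∀ U, |F U| ≤ M) →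
        IsGaugeInvariant F →
        DependsOn F {e : Edge 4 (2 * S + 1) |
          ((e.1 0 - s).val = 0 ∨ (e.1 0 - s).val = ℓ - 1) ∧ e.2 ≠ 0} →
      ε * ∫ U, (F U - ∫ V, F V ∂μ) ^ 2 ∂μ ≤
        ∫ U, (F U - condExp (cylinderEvents {e : Edge 4 (2 * S + 1) | ℓ ≤ (e.1 0 - s).val}) μ F U) ^ 2 ∂μ) →
    ∃ m : ℝ, 0 < m ∧ ∃ S₂ : ℕ, ∀ A B : YMSpecies G, ∃ C : ℝ, ∀ S n : ℕ, S₂ ≤ S → n ≤ S →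
      |latticeConnectedCorr r.ρ β (2 * S + 1) A.F B.F n| ≤ C * Real.exp (-(m * n)) :=
  Summit.QuantumFields.YangMills.Theorems.PoincareToGap.stub_gapAt_of_twoTimeRetention

/-! ### §1c Unconditional consequences of the crux hypothesis (lead c2, 2026-08-17): temporal `ℓ¹`-summability
and `1/(n+1)` decay of layer autocovariances (stubs F1–F4b, composed in §3)

The tori are SYMMETRIC, `(2S+1)⁴`.  The crux hypothesis is a Poincaré inequality for the law of the time-zero slice;
by the axis swap `0 ↔ 1` — an invariance of Wilson's measure (F2) — it is equally a Poincaré inequality for the law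
of the TIMELIKE slice `x₁ = 0`.  Applied (F1, in the time-zero picture) to the sum of the `2S+1` translates in
direction `1` of a bounded measurable gauge-invariant link-Lipschitz observable `A` of the layer
`Λ₀ = {t = 0, x₁ = 0, directions 2, 3}` (translates read disjoint links, so `dir` is additive while the variance of
the sum is `(2S+1) Σ_y Cov(A, A ∘ T¹_y)` by translation invariance) it bounds the susceptibility in direction `1`;
transported by the swap (F3) this is the TEMPORAL susceptibility bound `Σ_{n ∈ ℤ_{2S+1}} Cov(A, A ∘ T⁰_n) ≤ κ · dir A`.
Odd-torus reflection positivity (tree theorem `wilsonExpectation_oddReflectionPositive`, reflection `t ↦ 1 − t`,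
which on the odd torus has one link plane and one site plane) makes `c(n) := Cov(A, A ∘ T⁰_n)` non-negative, even and
log-convex on `ℤ_{2S+1} ∖ {0}` (F4: the Gram matrix `(c(s+t−1))_{s,t=1}^{S+1}` of the centred layer translates is
positive semi-definite; its diagonal and its consecutive `2 × 2` minors, plus `c(n) = c(2S+1−n)`), hence non-increasing
on `[0, S]` (F4b, elementary), and therefore `(n+1) c(n) ≤ Σ_{m=0}^{n} c(m) ≤ Σ_{m} c(m) ≤ κ · dir A`:
**`Cov_S(A, τ_n A) ≤ κ · dir(A) / (n+1)` for `n ≤ S`, uniformly in `S`** (§3, `temporalDecay_of_slicePoincare`).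
This is what the hypothesis yields with NO further input; the exponential rate asked by the crux is exactly PB1 ∧ PB2.
(`T^i_v := torusConfigShift (Pi.single i v)`, `(T^i_v U)(x, k) = U(x − v eᵢ, k)`.) -/

/-- F1 `stub_sliceCovSum_le` — **susceptibility bound in a spatial direction from the slice Poincaré inequality**
(LANDED p146864).  On one torus `(2S+1)⁴`, IF the crux hypothesis holds at this `S` (verbatim body), then for
every bounded measurable gauge-invariant link-Lipschitz `A` reading only time-zero spatial links based in the layer
`x₁ = 0`, `Σ_{y ∈ ℤ_{2S+1}} Cov_μ(A, A ∘ T¹_y) ≤ κ · dir A` (`dir` = the crux's time-zero Dirichlet form of `A`).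
Proof: `f := Σ_y A ∘ T¹_y` is admissible (gauge-invariant: shifts commute with gauge transformations; reads time-zero
spatial links; Lipschitz with constant `(2S+1)K` by reindexing the edge sum); the hypothesis gives `Var f ≤ κ dir f`;
`Var f = Σ_{y,y'} Cov(A∘T¹_y, A∘T¹_{y'}) = (2S+1) Σ_z Cov(A, A∘T¹_z)` (`wilsonMeasure_map_torusConfigShift`); every
time-zero spatial link `e` is read by exactly one translate (`y = −e.1 1`), for which
`|f(update U e g) − f U| = |A∘T¹_y(update U e g) − A∘T¹_y U|` and `A∘T¹_y (update U e g) = A (update (T¹_y U) ê g)` with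
`ê = (e.1 + y e₁, e.2)`, `(T¹_y U) ê = U e`, so `slope_e f (U) = slope_ê A (T¹_y U)` and, integrating with translation
invariance, `dir f = (2S+1) · Σ_{ê ∈ layer} ∫ slope_ê(A)² ≤ (2S+1) · dir A` (a sub-sum of non-negative terms; with
`κ ≥ 0` the inequality is all that is used). Divide by `2S+1`. -/
theorem stub_sliceCovSum_le :
    ∀ (G : Type) [Group G] [TopologicalSpace G] [IsTopologicalGroup G] [CompactSpace G]
      [MeasurableSpace G] [BorelSpace G] (r : LatticeRep G) (β κ : ℝ), 0 ≤ κ → ∀ S : ℕ,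
    (∀ f : GaugeConfig 4 (2 * S + 1) G → ℝ, IsGaugeInvariant f →
      (∀ U V : GaugeConfig 4 (2 * S + 1) G,
        (∀ e : Edge 4 (2 * S + 1), e.1 0 = 0 → e.2 ≠ 0 → U e = V e) → f U = f V) →
      (∃ K : ℝ, ∀ U V : GaugeConfig 4 (2 * S + 1) G,
        |f U - f V| ≤ K * ∑ e, Real.sqrt (∑ a, ∑ b, ‖(r.ρ (U e) - r.ρ (V e)) a b‖ ^ 2)) →
      ∫ U, (f U - ∫ V, f V ∂(wilsonMeasure r.ρ β : Measure (GaugeConfig 4 (2 * S + 1) G))) ^ 2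
          ∂(wilsonMeasure r.ρ β : Measure (GaugeConfig 4 (2 * S + 1) G)) ≤
        κ * ∑ e : Edge 4 (2 * S + 1), (if e.1 0 = 0 ∧ e.2 ≠ 0 then
          ∫ U, (Filter.limsup (fun g : G => |f (Function.update U e g) - f U| /
              Real.sqrt (∑ a, ∑ b, ‖(r.ρ g - r.ρ (U e)) a b‖ ^ 2)) (𝓝[≠] (U e))) ^ 2
            ∂(wilsonMeasure r.ρ β : Measure (GaugeConfig 4 (2 * S + 1) G)) else 0)) →
    ∀ μ : Measure (GaugeConfig 4 (2 * S + 1) G),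
      μ = (wilsonMeasure r.ρ β : Measure (GaugeConfig 4 (2 * S + 1) G)) →
    ∀ A : GaugeConfig 4 (2 * S + 1) G → ℝ, Measurable A → (∃ M : ℝ, ∀ U, |A U| ≤ M) →
      IsGaugeInvariant A →
      DependsOn A {e : Edge 4 (2 * S + 1) | e.1 0 = 0 ∧ e.1 1 = 0 ∧ e.2 ≠ 0} →
      (∃ K : ℝ, ∀ U V : GaugeConfig 4 (2 * S + 1) G,
        |A U - A V| ≤ K * ∑ e, Real.sqrt (∑ a, ∑ b, ‖(r.ρ (U e) - r.ρ (V e)) a b‖ ^ 2)) →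
    ∑ y : ZMod (2 * S + 1),
        (∫ U, A U * A (torusConfigShift (Pi.single (1 : Fin 4) y : Site 4 (2 * S + 1)) U) ∂μ -
          (∫ U, A U ∂μ) * ∫ U, A U ∂μ) ≤
      κ * ∑ e : Edge 4 (2 * S + 1), (if e.1 0 = 0 ∧ e.2 ≠ 0 then
          ∫ U, (Filter.limsup (fun g : G => |A (Function.update U e g) - A U| /
              Real.sqrt (∑ a, ∑ b, ‖(r.ρ g - r.ρ (U e)) a b‖ ^ 2)) (𝓝[≠] (U e))) ^ 2 ∂μ else 0) :=
  Summit.QuantumFields.YangMills.Theorems.PoincareToGap.stub_sliceCovSum_le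

/-- F2 `stub_wilsonMeasure_map_axisSwap` — **hypercubic symmetry: Wilson's torus measure is invariant under the
exchange of two coordinate axes** (LANDED p145329; the tree already had `wilsonMeasure_map_configPerm`).  For every `d`, `L`, every compact `G` with a faithful
unitary `r`, every real `β` and axes `i, j`, the push-forward of `wilsonMeasure r.ρ β` under
`U ↦ (x, k) ↦ U(x ∘ swap_{ij}, swap_{ij} k)` is `wilsonMeasure r.ρ β`.  Proof (template:
`wilsonMeasure_map_torusConfigShift` / `withDensity_map_of_measurableEquiv`): the map is the measurable equivalence
`MeasurableEquiv.arrowCongr'` of the edge bijection `(x, k) ↦ (x ∘ swap, swap k)` (an involution), so it preserves the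
product Haar measure (`measurePreserving_arrowCongr'`); and `wilsonAction` is invariant: the plaquette holonomy of
the swapped configuration at `(x; k, l)` is the holonomy of `U` at `(x ∘ swap; swap k, swap l)` (`Site.shift` commutes
with the swap: `(x + e_k) ∘ swap = x ∘ swap + e_{swap k}`), the plaquettes with `swap k < swap l` are re-indexed, and
those with `swap k > swap l` are the REVERSED plaquettes, `hol(x; l, k) = hol(x; k, l)⁻¹`, whose weight is unchanged
because `Re tr ρ(g⁻¹) = Re tr ρ(g)` for unitary `ρ(g)` (`r.mem_unitary`: `ρ(g⁻¹) = ρ(g)ᴴ`, `tr Mᴴ = conj (tr M)`). -/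
theorem stub_wilsonMeasure_map_axisSwap :
    ∀ (G : Type) [Group G] [TopologicalSpace G] [IsTopologicalGroup G] [CompactSpace G]
      [MeasurableSpace G] [BorelSpace G] (r : LatticeRep G) (β : ℝ) (d L : ℕ) [NeZero L] (i j : Fin d),
    (wilsonMeasure r.ρ β : Measure (GaugeConfig d L G)).map
        (fun (U : GaugeConfig d L G) (e : Edge d L) =>
          U (fun k => e.1 (Equiv.swap i j k), Equiv.swap i j e.2)) =
      (wilsonMeasure r.ρ β : Measure (GaugeConfig d L G)) :=
  Summit.QuantumFields.YangMills.Theorems.PoincareToGap.stub_wilsonMeasure_map_axisSwap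

/-- F3 `stub_axisSwap_transport` — **transport of a `(2,3)`-layer observable through the axis swap `0 ↔ 1`**
(LANDED p145575; pure bookkeeping, the swap invariance of `μ` is a HYPOTHESIS here and is F2).  Let
`Φ U (x, k) := U(x ∘ swap₀₁, swap₀₁ k)` and let `A` be bounded measurable gauge-invariant link-Lipschitz reading only
the layer `Λ₀ = {e | e.1 0 = 0 ∧ e.1 1 = 0 ∧ e.2 ∉ {0, 1}}`.  Then (i) `A ∘ Φ` is again bounded measurable
gauge-invariant (`Φ (gaugeTransform g U) = gaugeTransform (g ∘ swap) (Φ U)`) link-Lipschitz (re-index the edge sum by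
the edge involution) and reads only `{e | e.1 0 = 0 ∧ e.1 1 = 0 ∧ e.2 ≠ 0}` (`Φ` fixes `Λ₀` pointwise up to the site
swap); (ii) `Φ ∘ T¹_y = T⁰_y ∘ Φ` (`(y e₁) ∘ swap = y e₀`), so with `μ.map Φ = μ` the direction-`1` autocovariances of
`A ∘ Φ` are the TEMPORAL autocovariances of `A`, summed over `ℤ_{2S+1}`; (iii) `dir (A ∘ Φ) = dir A`:
`(A ∘ Φ)(update U e g) = A (update (Φ U) (ε e) g)` with `ε` the edge involution and `(Φ U)(ε e) = U e`, so
`slope_e (A ∘ Φ)(U) = slope_{ε e} A (Φ U)`; integrate with `μ.map Φ = μ`, re-index, and note that both Dirichlet sums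
only see the links of `Λ₀` (off `Λ₀` the difference quotient of `A` vanishes identically, `limsup 0 = 0`), on which
`ε` is the identity of the direction and the swap of the (equal, zero) coordinates `0, 1`. -/
theorem stub_axisSwap_transport :
    ∀ (G : Type) [Group G] [TopologicalSpace G] [IsTopologicalGroup G] [CompactSpace G]
      [MeasurableSpace G] [BorelSpace G] (r : LatticeRep G) (β : ℝ) (S : ℕ)
      (μ : Measure (GaugeConfig 4 (2 * S + 1) G)),
      μ = (wilsonMeasure r.ρ β : Measure (GaugeConfig 4 (2 * S + 1) G)) →
      μ.map (fun (U : GaugeConfig 4 (2 * S + 1) G) (e : Edge 4 (2 * S + 1)) =>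
          U (fun k => e.1 (Equiv.swap 0 1 k), Equiv.swap 0 1 e.2)) = μ →
    ∀ A : GaugeConfig 4 (2 * S + 1) G → ℝ, Measurable A → (∃ M : ℝ, ∀ U, |A U| ≤ M) →
      IsGaugeInvariant A →
      DependsOn A {e : Edge 4 (2 * S + 1) | e.1 0 = 0 ∧ e.1 1 = 0 ∧ e.2 ≠ 0 ∧ e.2 ≠ 1} →
      (∃ K : ℝ, ∀ U V : GaugeConfig 4 (2 * S + 1) G,
        |A U - A V| ≤ K * ∑ e, Real.sqrt (∑ a, ∑ b, ‖(r.ρ (U e) - r.ρ (V e)) a b‖ ^ 2)) →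
    (Measurable (fun U : GaugeConfig 4 (2 * S + 1) G =>
        A (fun e => U (fun k => e.1 (Equiv.swap 0 1 k), Equiv.swap 0 1 e.2))) ∧
      (∃ M : ℝ, ∀ U : GaugeConfig 4 (2 * S + 1) G,
        |A (fun e => U (fun k => e.1 (Equiv.swap 0 1 k), Equiv.swap 0 1 e.2))| ≤ M) ∧
      IsGaugeInvariant (fun U : GaugeConfig 4 (2 * S + 1) G =>
        A (fun e => U (fun k => e.1 (Equiv.swap 0 1 k), Equiv.swap 0 1 e.2))) ∧
      DependsOn (fun U : GaugeConfig 4 (2 * S + 1) G =>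
        A (fun e => U (fun k => e.1 (Equiv.swap 0 1 k), Equiv.swap 0 1 e.2)))
        {e : Edge 4 (2 * S + 1) | e.1 0 = 0 ∧ e.1 1 = 0 ∧ e.2 ≠ 0} ∧
      (∃ K : ℝ, ∀ U V : GaugeConfig 4 (2 * S + 1) G,
        |A (fun e => U (fun k => e.1 (Equiv.swap 0 1 k), Equiv.swap 0 1 e.2)) -
            A (fun e => V (fun k => e.1 (Equiv.swap 0 1 k), Equiv.swap 0 1 e.2))| ≤
          K * ∑ e, Real.sqrt (∑ a, ∑ b, ‖(r.ρ (U e) - r.ρ (V e)) a b‖ ^ 2))) ∧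
    (∑ y : ZMod (2 * S + 1),
        (∫ U, A (fun e => U (fun k => e.1 (Equiv.swap 0 1 k), Equiv.swap 0 1 e.2)) *
            A (fun e => (torusConfigShift (Pi.single (1 : Fin 4) y : Site 4 (2 * S + 1)) U)
              (fun k => e.1 (Equiv.swap 0 1 k), Equiv.swap 0 1 e.2)) ∂μ -
          (∫ U, A (fun e => U (fun k => e.1 (Equiv.swap 0 1 k), Equiv.swap 0 1 e.2)) ∂μ) *
            ∫ U, A (fun e => U (fun k => e.1 (Equiv.swap 0 1 k), Equiv.swap 0 1 e.2)) ∂μ) =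
      ∑ n : ZMod (2 * S + 1),
        (∫ U, A U * A (torusConfigShift (Pi.single (0 : Fin 4) n : Site 4 (2 * S + 1)) U) ∂μ -
          (∫ U, A U ∂μ) * ∫ U, A U ∂μ)) ∧
    (∑ e : Edge 4 (2 * S + 1), (if e.1 0 = 0 ∧ e.2 ≠ 0 then
        ∫ U, (Filter.limsup (fun g : G =>
            |A (fun e' => (Function.update U e g) (fun k => e'.1 (Equiv.swap 0 1 k), Equiv.swap 0 1 e'.2)) -
              A (fun e' => U (fun k => e'.1 (Equiv.swap 0 1 k), Equiv.swap 0 1 e'.2))| /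
            Real.sqrt (∑ a, ∑ b, ‖(r.ρ g - r.ρ (U e)) a b‖ ^ 2)) (𝓝[≠] (U e))) ^ 2 ∂μ else 0) =
      ∑ e : Edge 4 (2 * S + 1), (if e.1 0 = 0 ∧ e.2 ≠ 0 then
        ∫ U, (Filter.limsup (fun g : G => |A (Function.update U e g) - A U| /
            Real.sqrt (∑ a, ∑ b, ‖(r.ρ g - r.ρ (U e)) a b‖ ^ 2)) (𝓝[≠] (U e))) ^ 2 ∂μ else 0)) :=
  Summit.QuantumFields.YangMills.Theorems.PoincareToGap.stub_axisSwap_transport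

/-- F4 `stub_cov_nonneg_logConvex` — **reflection positivity makes torus layer autocovariances non-negative, even and
log-convex** (LANDED p146262).  For `0 ≤ β`, `S ≥ 1`, and a bounded measurable `A` reading only time-zero
SPATIAL links (no gauge invariance needed), put `c(n) := Cov_μ(A, A ∘ T⁰_n)`, `n ∈ ℤ_{2S+1}`.  Then `c(n) ≥ 0`,
`c(−n) = c(n)`, and `c(n)² ≤ c(n−1) c(n+1)` for `n ≠ 0`.  Proof: with `F_t := A ∘ T⁰_{−t} − ∫A` (reads the spatial
links of slice `t`; for `1 ≤ t ≤ S+1` it reads `oPosEdges ∪ oSharedEdges`), `F_t ∘ timeReflect = F_{1−t}` (the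
reflection `t ↦ 1 − t` only moves the time coordinate of spatial links; `A` ignores temporal links), translation
invariance gives `∫ F_s' F_t = c(t − s')`, so `wilsonExpectation_oddReflectionPositive` (odd `L = 2S+1 ≥ 3`, `β ≥ 0`,
`r.continuous`) applied to `a F_s + b F_t` (`a, b ∈ ℝ`, `1 ≤ s, t ≤ S+1`) makes the real quadratic form of the Hankel
matrix `(c(s+t−1))_{s,t}` non-negative: diagonal ⇒ `c(2s−1) ≥ 0`; `2×2` minors `{s, s+1}` ⇒ `c(2s)² ≤ c(2s−1)c(2s+1)`;
evenness from translation invariance; `c(2S+1−n) = c(n)` turns the odd/even cases into all `n ≠ 0`. -/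
theorem stub_cov_nonneg_logConvex :
    ∀ (G : Type) [Group G] [TopologicalSpace G] [IsTopologicalGroup G] [CompactSpace G]
      [MeasurableSpace G] [BorelSpace G] (r : LatticeRep G) (β : ℝ), 0 ≤ β → ∀ S : ℕ, 1 ≤ S →
    ∀ μ : Measure (GaugeConfig 4 (2 * S + 1) G),
      μ = (wilsonMeasure r.ρ β : Measure (GaugeConfig 4 (2 * S + 1) G)) →
    ∀ A : GaugeConfig 4 (2 * S + 1) G → ℝ, Measurable A → (∃ M : ℝ, ∀ U, |A U| ≤ M) →
      DependsOn A {e : Edge 4 (2 * S + 1) | e.1 0 = 0 ∧ e.2 ≠ 0} →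
    (∀ n : ZMod (2 * S + 1),
        0 ≤ ∫ U, A U * A (torusConfigShift (Pi.single (0 : Fin 4) n : Site 4 (2 * S + 1)) U) ∂μ -
          (∫ U, A U ∂μ) * ∫ U, A U ∂μ) ∧
    (∀ n : ZMod (2 * S + 1),
        ∫ U, A U * A (torusConfigShift (Pi.single (0 : Fin 4) (-n) : Site 4 (2 * S + 1)) U) ∂μ =
          ∫ U, A U * A (torusConfigShift (Pi.single (0 : Fin 4) n : Site 4 (2 * S + 1)) U) ∂μ) ∧
    (∀ n : ZMod (2 * S + 1), n ≠ 0 →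
        (∫ U, A U * A (torusConfigShift (Pi.single (0 : Fin 4) n : Site 4 (2 * S + 1)) U) ∂μ -
            (∫ U, A U ∂μ) * ∫ U, A U ∂μ) ^ 2 ≤
          (∫ U, A U * A (torusConfigShift (Pi.single (0 : Fin 4) (n - 1) : Site 4 (2 * S + 1)) U) ∂μ -
              (∫ U, A U ∂μ) * ∫ U, A U ∂μ) *
            (∫ U, A U * A (torusConfigShift (Pi.single (0 : Fin 4) (n + 1) : Site 4 (2 * S + 1)) U) ∂μ -
              (∫ U, A U ∂μ) * ∫ U, A U ∂μ)) :=
  Summit.QuantumFields.YangMills.Theorems.PoincareToGap.stub_cov_nonneg_logConvex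

/-- F4b `stub_antitone_of_logConvex` — **a non-negative, even, log-convex function on the odd cycle is non-increasing
on `[0, S]`** (elementary; LANDED p145324).  For `c : ℤ_{2S+1} → ℝ` with `c ≥ 0`, `c(−n) = c(n)` and
`c(n)² ≤ c(n−1)c(n+1)` for `n ≠ 0`: `c(k) ≤ c(n)` whenever `0 ≤ n ≤ k ≤ S`.  Proof: if some `c(n₀) = 0` with `n₀ ≠ 0`,
log-convexity at the neighbours propagates the zero to every `n ≠ 0`, and the claim is trivial.  Otherwise all
`c(n) > 0` for `n ≠ 0` and the ratios `c(n+1)/c(n)` are non-decreasing along `n = 1, …, 2S−1`; if `c(k) > c(n)` for some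
`1 ≤ n < k ≤ S`, a ratio `> 1` at some `j ≤ S−1` forces `c` strictly increasing on `[j, 2S]`, contradicting
`c(2S−j) = c(j+1)` (`2S − j > j + 1`); finally `c(1)² ≤ c(0)c(2) ≤ c(0)c(1)` gives `c(1) ≤ c(0)`. -/
theorem stub_antitone_of_logConvex :
    ∀ (S : ℕ) (c : ZMod (2 * S + 1) → ℝ), (∀ n, 0 ≤ c n) → (∀ n, c (-n) = c n) →
      (∀ n, n ≠ 0 → c n ^ 2 ≤ c (n - 1) * c (n + 1)) →
    ∀ n k : ℕ, n ≤ k → k ≤ S → c (k : ZMod (2 * S + 1)) ≤ c (n : ZMod (2 * S + 1)) :=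
  Summit.QuantumFields.YangMills.Theorems.PoincareToGap.stub_antitone_of_logConvex

/-! ### §1d Extensions of the free consequence (lead c2, wave 2): cross-covariances and the plaquette species

G1 is reflection positivity in Cauchy–Schwarz form for TWO layer observables (the off-diagonal companion of F4);
G2 is the time-reversal invariance of Wilson's measure (makes cross-covariances even in the separation); G3 makes the `(2,3)`-plaquette species an admissible layer observable with explicit constants (Lipschitz constant
`√N`, Dirichlet form `≤ 4N`).  With §3 they give (§3b) `|Cov_S(A, τ_n B)| ≤ 2κ √(dir A · dir B)/(n+1)` for pairs
and, for the plaquette species `O = plaquetteObservable r.ρ _ 2 3` of the crux's conclusion,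
`0 ≤ latticeConnectedCorr r.ρ β (2S+1) O.F O.F n ≤ 4 κ N/(n+1)` for `n ≤ S`, `S ≥ max S₀ 1` — the crux's
conclusion for this pair with `C e^{−m n}` replaced by `4κN/(n+1)`.  Wave 2 (three stub-workers) LANDED G1 p151226,
G2 p151134, G3 p152075. -/

/-- G1 `stub_crossCov_sq_le` — **reflection positivity, Cauchy–Schwarz form, for two layer observables**
(LANDED p151226).  For `0 ≤ β`, `S ≥ 1`, bounded
measurable `A, B` reading only time-zero SPATIAL links, and residues `s, t` with `1 ≤ s.val, t.val ≤ S + 1`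
(`T v := torusConfigShift (v e₀)`): `(∫ Ã · B̃ ∘ T_{1−s−t} + ∫ Ã · B̃ ∘ T_{s+t−1})² ≤ 4 (∫ Ã · Ã ∘ T_{1−2s}) (∫ B̃ · B̃ ∘ T_{1−2t})`
(`Ã = A − ∫A`, written out as `∫ A·(B∘T) − (∫A)(∫B)` etc.; the SYMMETRISED cross term is what reflection positivity
delivers for `A ≠ B` — the two cross pairings `⟨ΘF·G⟩`, `⟨ΘG·F⟩` are `∫ Ã · B̃∘T_{1−s−t}` and `∫ Ã · B̃∘T_{s+t−1}`;
they coincide once the time-reversal symmetry G2 is used, which the lead does in §3c).  Proof: with `F := Ã ∘ T_{−s}` (centred copy of `A`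
on the spatial links of slice `s`) and `G := B̃ ∘ T_{−t}`, both depending only on `oPosEdges ∪ oSharedEdges`,
`wilsonExpectation_oddReflectionPositive` (real form: `covLC_integral_timeReflect_mul_self_nonneg`) applied to the real
combinations `a F + b G` gives a non-negative real quadratic form `a² ⟨ΘF·F⟩ + ab (⟨ΘF·G⟩ + ⟨ΘG·F⟩) + b² ⟨ΘG·G⟩`
(`covLC_integral_lin_mul_lin`); `F ∘ Θ = Ã ∘ T_{−(1−s)}` (the reflection `t ↦ 1 − t` moves
only the time coordinate of spatial links), and translation invariance turns the three pairings into the three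
integrals of the statement (`covLC_layer_timeReflect`, `covLC_layer_dependsOn`, `covLC_integral_comp_shift_mul_comp_shift`);
the `2 × 2` discriminant (`covLC_sq_le_mul` with `q` = half the symmetrised term) is the claim. -/
theorem stub_crossCov_sq_le :
    ∀ (G : Type) [Group G] [TopologicalSpace G] [IsTopologicalGroup G] [CompactSpace G]
      [MeasurableSpace G] [BorelSpace G] (r : LatticeRep G) (β : ℝ), 0 ≤ β → ∀ S : ℕ, 1 ≤ S →
    ∀ μ : Measure (GaugeConfig 4 (2 * S + 1) G),
      μ = (wilsonMeasure r.ρ β : Measure (GaugeConfig 4 (2 * S + 1) G)) →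
    ∀ A B : GaugeConfig 4 (2 * S + 1) G → ℝ, Measurable A → Measurable B →
      (∃ M : ℝ, ∀ U, |A U| ≤ M) → (∃ M : ℝ, ∀ U, |B U| ≤ M) →
      DependsOn A {e : Edge 4 (2 * S + 1) | e.1 0 = 0 ∧ e.2 ≠ 0} →
      DependsOn B {e : Edge 4 (2 * S + 1) | e.1 0 = 0 ∧ e.2 ≠ 0} →
    ∀ s t : ZMod (2 * S + 1), 1 ≤ s.val → s.val ≤ S + 1 → 1 ≤ t.val → t.val ≤ S + 1 →
      ((∫ U, A U * B (torusConfigShift (Pi.single (0 : Fin 4) (1 - s - t) : Site 4 (2 * S + 1)) U) ∂μ -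
          (∫ U, A U ∂μ) * ∫ U, B U ∂μ) +
        (∫ U, A U * B (torusConfigShift (Pi.single (0 : Fin 4) (s + t - 1) : Site 4 (2 * S + 1)) U) ∂μ -
          (∫ U, A U ∂μ) * ∫ U, B U ∂μ)) ^ 2 ≤
        4 * (∫ U, A U * A (torusConfigShift (Pi.single (0 : Fin 4) (1 - 2 * s) : Site 4 (2 * S + 1)) U) ∂μ -
            (∫ U, A U ∂μ) * ∫ U, A U ∂μ) *
          (∫ U, B U * B (torusConfigShift (Pi.single (0 : Fin 4) (1 - 2 * t) : Site 4 (2 * S + 1)) U) ∂μ -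
            (∫ U, B U ∂μ) * ∫ U, B U ∂μ) :=
  Summit.QuantumFields.YangMills.Theorems.PoincareToGap.stub_crossCov_sq_le

/-- G2 `stub_wilsonMeasure_timeReflect_invariant` — **time-reversal symmetry: Wilson's torus measure is
invariant under the Osterwalder–Seiler reflection `Θ` (`GaugeConfig.timeReflect`, `θ t = 1 − t`)** (LANDED p151134).  For every `d, L` (`NeZero`), compact `G`, faithful unitary `r`, real `β`: the push-forward of
`wilsonMeasure r.ρ β` under `Θ` is itself, equivalently `∫ f ∘ Θ dμ = ∫ f dμ` for every real `f`.  Proof: `Θ` is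
an involution (`WilsonRP.timeReflect_apply`, `Site.timeReflect_timeReflect`), measurable
(`WilsonRP.measurable_timeReflect`), preserves the product Haar measure (`WilsonRP.measurePreserving_timeReflect`,
`LatticeRP.piMeasure = Measure.pi`) and the Wilson action (`WilsonRP.wilsonAction_eq`, `WilsonRP.plaqRe_timeReflect`:
`Re tr ρ((ΘU)_p) = Re tr ρ(U_{ϑp})` with `ϑ = WilsonRP.plaqReflect` a bijection of the plaquettes), hence the
density `exp(−β S)` and the normalisation; package `Θ` as a `MeasurableEquiv` (involution) and use
`withDensity_map_of_measurableEquiv` as in `wilsonMeasure_map_torusConfigShift`; the integral form is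
`MeasureTheory.integral_map_equiv`. -/
theorem stub_wilsonMeasure_timeReflect_invariant :
    ∀ (G : Type) [Group G] [TopologicalSpace G] [IsTopologicalGroup G] [CompactSpace G]
      [MeasurableSpace G] [BorelSpace G] (r : LatticeRep G) (β : ℝ) (d L : ℕ) [NeZero d] [NeZero L],
    (wilsonMeasure r.ρ β : Measure (GaugeConfig d L G)).map GaugeConfig.timeReflect =
        (wilsonMeasure r.ρ β : Measure (GaugeConfig d L G)) ∧
      ∀ f : GaugeConfig d L G → ℝ,
        ∫ U, f U.timeReflect ∂(wilsonMeasure r.ρ β : Measure (GaugeConfig d L G)) =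
          ∫ U, f U ∂(wilsonMeasure r.ρ β : Measure (GaugeConfig d L G)) :=
  Summit.QuantumFields.YangMills.Theorems.PoincareToGap.stub_wilsonMeasure_timeReflect_invariant

/-- G3 `stub_plaquette_admissible` — **the `(2,3)`-plaquette species is an admissible layer observable, with
explicit constants** (LANDED p152075).  On the torus `(2S+1)⁴`, `S ≥ 1`, the torus reading
`P U = plaquetteObs r.ρ 0 2 3 (torusLift (2S+1) U) = Re tr r.ρ(U(0,2) U(e₂,3) U(e₃,2)⁻¹ U(0,3)⁻¹)` of the plaquette
species `plaquetteObservable r.ρ _ 2 3` (the `A = B` of the crux's conclusion one would test first) is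
gauge-invariant, reads only the `(2,3)`-layer `Λ₀ = {t = 0, x₁ = 0, directions 2, 3}`, is link-Lipschitz with
constant `√N` (unitarity: replacing one unitary factor changes the product by the same Frobenius amount,
`|Re tr M| ≤ √N ‖M‖_F`; `‖ρ(g)⁻¹ − ρ(h)⁻¹‖_F = ‖ρ(g) − ρ(h)‖_F`), and its time-zero Dirichlet form is `≤ 4N` under
ANY probability measure (the four plaquette links are distinct for `S ≥ 1`; on each the difference quotient is
`≤ √N`, so `limsup ≤ √N` — `Filter.limsup_le_of_le` with `isCoboundedUnder_le_of_le` when `𝓝[≠]` is `NeBot`, and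
`limsup = sInf univ = 0` when it is `⊥`; every other slice link is not read, difference quotient `≡ 0`). -/
theorem stub_plaquette_admissible :
    ∀ (G : Type) [Group G] [TopologicalSpace G] [IsTopologicalGroup G] [CompactSpace G]
      [MeasurableSpace G] [BorelSpace G] (r : LatticeRep G) (S : ℕ), 1 ≤ S →
    IsGaugeInvariant (fun U : GaugeConfig 4 (2 * S + 1) G =>
        plaquetteObs r.ρ 0 2 3 (torusLift (2 * S + 1) U)) ∧
    DependsOn (fun U : GaugeConfig 4 (2 * S + 1) G => plaquetteObs r.ρ 0 2 3 (torusLift (2 * S + 1) U))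
      {e : Edge 4 (2 * S + 1) | e.1 0 = 0 ∧ e.1 1 = 0 ∧ e.2 ≠ 0 ∧ e.2 ≠ 1} ∧
    (∀ U V : GaugeConfig 4 (2 * S + 1) G,
      |plaquetteObs r.ρ 0 2 3 (torusLift (2 * S + 1) U) - plaquetteObs r.ρ 0 2 3 (torusLift (2 * S + 1) V)| ≤
        Real.sqrt r.N * ∑ e, Real.sqrt (∑ a, ∑ b, ‖(r.ρ (U e) - r.ρ (V e)) a b‖ ^ 2)) ∧
    (∀ μ : Measure (GaugeConfig 4 (2 * S + 1) G), IsProbabilityMeasure μ →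
      ∑ e : Edge 4 (2 * S + 1), (if e.1 0 = 0 ∧ e.2 ≠ 0 then
        ∫ U, (Filter.limsup (fun g : G =>
            |plaquetteObs r.ρ 0 2 3 (torusLift (2 * S + 1) (Function.update U e g)) -
                plaquetteObs r.ρ 0 2 3 (torusLift (2 * S + 1) U)| /
              Real.sqrt (∑ a, ∑ b, ‖(r.ρ g - r.ρ (U e)) a b‖ ^ 2)) (𝓝[≠] (U e))) ^ 2 ∂μ else 0) ≤
        4 * r.N) :=
  Summit.QuantumFields.YangMills.Theorems.PoincareToGap.stub_plaquette_admissible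

/-! ### §2 The composition (sorry-free) -/

/-- **Two-time arc retention from the slice Poincaré hypothesis** (the former registered heart H1, a
THEOREM modulo the open cores): PB1 and PB2 give `θ₁, θ₂ < 1` on all tori beyond `max S₁ S₂`, and C1 turns
them into retention with `ε = (1 − θ₁)(1 − θ₂) ∈ (0, 1]`. -/
theorem twoTimeRetention_of_slicePoincare :
    ∀ (G : Type) [Group G] [TopologicalSpace G] [IsTopologicalGroup G] [CompactSpace G]
      [MeasurableSpace G] [BorelSpace G], IsCompactSimpleLieGroup G →
    ∀ (r : LatticeRep G) (β : ℝ), 0 < β → ∀ κ : ℝ, 0 < κ → ∀ S₀ : ℕ,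
    (∀ S : ℕ, S₀ ≤ S → ∀ f : GaugeConfig 4 (2 * S + 1) G → ℝ, IsGaugeInvariant f →
      (∀ U V : GaugeConfig 4 (2 * S + 1) G,
        (∀ e : Edge 4 (2 * S + 1), e.1 0 = 0 → e.2 ≠ 0 → U e = V e) → f U = f V) →
      (∃ K : ℝ, ∀ U V : GaugeConfig 4 (2 * S + 1) G,
        |f U - f V| ≤ K * ∑ e, Real.sqrt (∑ a, ∑ b, ‖(r.ρ (U e) - r.ρ (V e)) a b‖ ^ 2)) →
      ∫ U, (f U - ∫ V, f V ∂(wilsonMeasure r.ρ β : Measure (GaugeConfig 4 (2 * S + 1) G))) ^ 2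
          ∂(wilsonMeasure r.ρ β : Measure (GaugeConfig 4 (2 * S + 1) G)) ≤
        κ * ∑ e : Edge 4 (2 * S + 1), (if e.1 0 = 0 ∧ e.2 ≠ 0 then
          ∫ U, (Filter.limsup (fun g : G => |f (Function.update U e g) - f U| /
              Real.sqrt (∑ a, ∑ b, ‖(r.ρ g - r.ρ (U e)) a b‖ ^ 2)) (𝓝[≠] (U e))) ^ 2
            ∂(wilsonMeasure r.ρ β : Measure (GaugeConfig 4 (2 * S + 1) G)) else 0)) →
    ∃ ε : ℝ, 0 < ε ∧ ε ≤ 1 ∧ ∃ S₁ : ℕ, ∀ S : ℕ, S₁ ≤ S →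
      ∀ μ : Measure (GaugeConfig 4 (2 * S + 1) G),
        μ = (wilsonMeasure r.ρ β : Measure (GaugeConfig 4 (2 * S + 1) G)) →
      ∀ (s : ZMod (2 * S + 1)) (ℓ : ℕ), 3 ≤ ℓ → ℓ + 3 ≤ 2 * S + 1 →
      ∀ F : GaugeConfig 4 (2 * S + 1) G → ℝ, Measurable F → (∃ M : ℝ, ∀ U, |F U| ≤ M) →
        IsGaugeInvariant F →
        DependsOn F {e : Edge 4 (2 * S + 1) |
          ((e.1 0 - s).val = 0 ∨ (e.1 0 - s).val = ℓ - 1) ∧ e.2 ≠ 0} →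
      ε * ∫ U, (F U - ∫ V, F V ∂μ) ^ 2 ∂μ ≤
        ∫ U, (F U - condExp (cylinderEvents {e : Edge 4 (2 * S + 1) | ℓ ≤ (e.1 0 - s).val}) μ F U) ^ 2 ∂μ := by
  intro G _ _ _ _ _ _ hG r β hβ κ hκ S₀ hP
  obtain ⟨θ₁, h10, h11, S₁, hPB1⟩ := oneSliceProjectionBound_of_slicePoincare G hG r β hβ κ hκ S₀ hP
  obtain ⟨θ₂, h20, h21, S₂, hPB2⟩ := stub_conditionalProjectionBound_of_slicePoincare G hG r β hβ κ hκ S₀ hP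
  refine ⟨(1 - θ₁) * (1 - θ₂), mul_pos (by linarith) (by linarith),
    by nlinarith [mul_nonneg h10 h20], max S₁ S₂, fun S hS => ?_⟩
  exact stub_twoTimeRetention_of_projectionBounds G r β θ₁ θ₂ h10 h11 h20 h21 (max S₁ S₂)
    (fun S' hS' => hPB1 S' (le_trans (le_max_left _ _) hS'))
    (fun S' hS' => hPB2 S' (le_trans (le_max_right _ _) hS')) S hS

/-- **Cyclic peeling closes the crux modulo its stubs.**  PB1 ∧ PB2 (open cores) ⟶ C1 two-time arc
retention with `ε ∈ (0,1]` on all tori `S ≥ S₁` ⟶ C2 the clustering body of the crux.  The crux hypothesis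
(a `let`-cascade) is handed to the `let`-free restatements by definitional unfolding. -/
theorem PoincareToGap_of : Summit.QuantumFields.YangMills.Theses.ConvexGribovBody.PoincareToGap := by
  intro G _ _ _ _ _ _ hG r β hβ κ hκ S₀ hP
  obtain ⟨ε, hε0, hε1, S₁, hR⟩ :=
    twoTimeRetention_of_slicePoincare G hG r β hβ κ hκ S₀ (fun S hS => hP S hS)
  exact stub_gapAt_of_twoTimeRetention G r β ε hε0 hε1 S₁ hR


/-! ### §1f Alternative, PIN-FREE residue (lead c3, 2026-08-17): PoincareToGap ⟸ HL ∧ SWA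

Cruxes/PoincareToGap/NOTES.md §10.5.  PB2 (§1, knot K-b) is a far-PINNED statement and, like every conditional inequality
quantified over all bounded test functions of the far side, is an ess-sup-over-pins statement up to `β^{-1/2}` fuzz (zooming);
the crux hypothesis has no known way to feed it.  The pin-free alternative: strengthen the one-slice Poincaré hypothesis to the
TWO-END-SLICE Poincaré inequality HYP₂ (joint law of the two end slices of an arc, Dirichlet form over both; a marginal of `μ`,
no conditioning), under which two-time arc retention follows DIRECTLY from an arc smooth witness (L1_arc p157847) and C2 closes
(`gapAt_of_twoSlicePoincare_of_smoothWitnessArc`, LANDED p158092).  As stubs of the crux AS TYPED: HL (one-slice ⇒ two-slice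
Poincaré: the decorrelation input in Poincaré language, pin-free — moot if K1's mechanism is asked for HYP₂ directly) and SWA
(hypothesis-free, pin-free arc smooth witness, sibling of SW).  `PoincareToGap_of_twoSlice` is a second sorry-free-modulo-stubs
proof of the crux by name; the registered residue of the line is thus {SW, PB2} or {HL, SWA}. -/

/-- HL `stub_twoSlicePoincare_of_slicePoincare` — **OPEN (knot K-b, pin-free form): one-slice Poincaré ⇒ two-end-slice
Poincaré.**  The crux hypothesis (Poincaré(κ) for gauge-invariant link-Lipschitz functions of the time-zero spatial links, all
tori `S ≥ S₀`) implies, for some `κ₂` and `S₀'`, the Poincaré inequality `Var f ≤ κ₂ dir_{s,ℓ} f` for gauge-invariant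
link-Lipschitz `f` reading the spatial links of the two END slices of any arc (`3 ≤ ℓ`, `ℓ + 3 ≤ 2S+1`), Dirichlet form over
those links.  Content: approximate tensorisation of the Poincaré inequality across two time slices at separation `≥ 2` =
decorrelation of slices in time (gap strength); exact with `κ₂ = κ` for independent slices; Gaussian `κ₂ ≤ 2κ`.  Recommended
to the planner as the RE-TYPED hypothesis of K3 (then this stub disappears and K1's column owes HYP₂). -/
theorem stub_twoSlicePoincare_of_slicePoincare :
    ∀ (G : Type) [Group G] [TopologicalSpace G] [IsTopologicalGroup G] [CompactSpace G]
      [MeasurableSpace G] [BorelSpace G], IsCompactSimpleLieGroup G →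
    ∀ (r : LatticeRep G) (β : ℝ), 0 < β → ∀ κ : ℝ, 0 < κ → ∀ S₀ : ℕ,
    (∀ S : ℕ, S₀ ≤ S → ∀ f : GaugeConfig 4 (2 * S + 1) G → ℝ, IsGaugeInvariant f →
      (∀ U V : GaugeConfig 4 (2 * S + 1) G,
        (∀ e : Edge 4 (2 * S + 1), e.1 0 = 0 → e.2 ≠ 0 → U e = V e) → f U = f V) →
      (∃ K : ℝ, ∀ U V : GaugeConfig 4 (2 * S + 1) G,
        |f U - f V| ≤ K * ∑ e, Real.sqrt (∑ a, ∑ b, ‖(r.ρ (U e) - r.ρ (V e)) a b‖ ^ 2)) →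
      ∫ U, (f U - ∫ V, f V ∂(wilsonMeasure r.ρ β : Measure (GaugeConfig 4 (2 * S + 1) G))) ^ 2
          ∂(wilsonMeasure r.ρ β : Measure (GaugeConfig 4 (2 * S + 1) G)) ≤
        κ * ∑ e : Edge 4 (2 * S + 1), (if e.1 0 = 0 ∧ e.2 ≠ 0 then
          ∫ U, (Filter.limsup (fun g : G => |f (Function.update U e g) - f U| /
              Real.sqrt (∑ a, ∑ b, ‖(r.ρ g - r.ρ (U e)) a b‖ ^ 2)) (𝓝[≠] (U e))) ^ 2
            ∂(wilsonMeasure r.ρ β : Measure (GaugeConfig 4 (2 * S + 1) G)) else 0)) →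
    ∃ κ₂ : ℝ, 0 < κ₂ ∧ ∃ S₀' : ℕ,
    (∀ S : ℕ, S₀' ≤ S → ∀ (s : ZMod (2 * S + 1)) (ℓ : ℕ), 3 ≤ ℓ → ℓ + 3 ≤ 2 * S + 1 →
      ∀ f : GaugeConfig 4 (2 * S + 1) G → ℝ, IsGaugeInvariant f →
      (∀ U V : GaugeConfig 4 (2 * S + 1) G,
        (∀ e : Edge 4 (2 * S + 1), ((e.1 0 - s).val = 0 ∨ (e.1 0 - s).val = ℓ - 1) → e.2 ≠ 0 → U e = V e) →
          f U = f V) →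
      (∃ K : ℝ, ∀ U V : GaugeConfig 4 (2 * S + 1) G,
        |f U - f V| ≤ K * ∑ e, Real.sqrt (∑ a, ∑ b, ‖(r.ρ (U e) - r.ρ (V e)) a b‖ ^ 2)) →
      ∫ U, (f U - ∫ V, f V ∂(wilsonMeasure r.ρ β : Measure (GaugeConfig 4 (2 * S + 1) G))) ^ 2
          ∂(wilsonMeasure r.ρ β : Measure (GaugeConfig 4 (2 * S + 1) G)) ≤
        κ₂ * ∑ e : Edge 4 (2 * S + 1), (if ((e.1 0 - s).val = 0 ∨ (e.1 0 - s).val = ℓ - 1) ∧ e.2 ≠ 0 then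
          ∫ U, (Filter.limsup (fun g : G => |f (Function.update U e g) - f U| /
              Real.sqrt (∑ a, ∑ b, ‖(r.ρ g - r.ρ (U e)) a b‖ ^ 2)) (𝓝[≠] (U e))) ^ 2
            ∂(wilsonMeasure r.ρ β : Measure (GaugeConfig 4 (2 * S + 1) G)) else 0)) := by
  sorry

/-- SWA `stub_smoothWitnessArc` — **OPEN HEART (hypothesis-free, pin-free): the ARC SMOOTH WITNESS.**  For every compact simple
`G`, `r`, `β > 0` there are `C > 0`, `S₁` such that on all tori `S ≥ S₁`, for every arc (`s`, `3 ≤ ℓ`, `ℓ + 3 ≤ 2S+1`) and every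
bounded measurable gauge-invariant `F` reading the spatial links `E_{s,ℓ}` of its two end slices there is an admissible `F₁`
(measurable, bounded, gauge-invariant, reading `E_{s,ℓ}`, link-Lipschitz) with
`dir_{s,ℓ}(F₁)/β + ∫ (F − F₁)² ≤ C ∫ (F − E_μ[F | outside the arc])²` — resampling the whole arc given its outside loses at least
`1/C` of what it costs to smooth `F` at scale `β^{-1/2}` in the end-slice links (K-functional form of slow-mode regularity of the
arc heat bath; sibling of SW; cannot be zoomed: `F` lives on resampled variables). -/
theorem stub_smoothWitnessArc :
    ∀ (G : Type) [Group G] [TopologicalSpace G] [IsTopologicalGroup G] [CompactSpace G]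
      [MeasurableSpace G] [BorelSpace G], IsCompactSimpleLieGroup G →
    ∀ (r : LatticeRep G) (β : ℝ), 0 < β →
    ∃ C : ℝ, 0 < C ∧ ∃ S₁ : ℕ,
    (∀ S : ℕ, S₁ ≤ S → ∀ μ : Measure (GaugeConfig 4 (2 * S + 1) G),
      μ = (wilsonMeasure r.ρ β : Measure (GaugeConfig 4 (2 * S + 1) G)) →
      ∀ (s : ZMod (2 * S + 1)) (ℓ : ℕ), 3 ≤ ℓ → ℓ + 3 ≤ 2 * S + 1 →
      ∀ F : GaugeConfig 4 (2 * S + 1) G → ℝ, Measurable F → (∃ M : ℝ, ∀ U, |F U| ≤ M) →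
      IsGaugeInvariant F →
      DependsOn F {e : Edge 4 (2 * S + 1) | ((e.1 0 - s).val = 0 ∨ (e.1 0 - s).val = ℓ - 1) ∧ e.2 ≠ 0} →
      ∃ F₁ : GaugeConfig 4 (2 * S + 1) G → ℝ, Measurable F₁ ∧ (∃ M : ℝ, ∀ U, |F₁ U| ≤ M) ∧
        IsGaugeInvariant F₁ ∧
        (∀ U V : GaugeConfig 4 (2 * S + 1) G,
          (∀ e : Edge 4 (2 * S + 1), ((e.1 0 - s).val = 0 ∨ (e.1 0 - s).val = ℓ - 1) → e.2 ≠ 0 → U e = V e) →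
            F₁ U = F₁ V) ∧
        (∃ K : ℝ, ∀ U V : GaugeConfig 4 (2 * S + 1) G,
          |F₁ U - F₁ V| ≤ K * ∑ e, Real.sqrt (∑ a, ∑ b, ‖(r.ρ (U e) - r.ρ (V e)) a b‖ ^ 2)) ∧
        (∑ e : Edge 4 (2 * S + 1), (if ((e.1 0 - s).val = 0 ∨ (e.1 0 - s).val = ℓ - 1) ∧ e.2 ≠ 0 then
            ∫ U, (Filter.limsup (fun g : G => |F₁ (Function.update U e g) - F₁ U| /
                Real.sqrt (∑ a, ∑ b, ‖(r.ρ g - r.ρ (U e)) a b‖ ^ 2)) (𝓝[≠] (U e))) ^ 2 ∂μ else 0)) / β +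
          ∫ U, (F U - F₁ U) ^ 2 ∂μ ≤
        C * ∫ U, (F U - condExp (cylinderEvents
            {e : Edge 4 (2 * S + 1) | ℓ ≤ (e.1 0 - s).val}) μ F U) ^ 2 ∂μ) := by
  sorry

/-- **Second closure of the crux modulo stubs (pin-free residue HL ∧ SWA).**  HL turns the hypothesis into HYP₂; SWA and the
landed interface `gapAt_of_twoSlicePoincare_of_smoothWitnessArc` (L1_arc + C2) conclude. -/
theorem PoincareToGap_of_twoSlice : Summit.QuantumFields.YangMills.Theses.ConvexGribovBody.PoincareToGap := by
  intro G _ _ _ _ _ _ hG r β hβ κ hκ S₀ hP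
  obtain ⟨κ₂, _, S₀', hP2⟩ := stub_twoSlicePoincare_of_slicePoincare G hG r β hβ κ hκ S₀ (fun S hS => hP S hS)
  obtain ⟨C, _, S₁, hSW⟩ := stub_smoothWitnessArc G hG r β hβ
  exact Summit.QuantumFields.YangMills.Theorems.PoincareToGap.gapAt_of_twoSlicePoincare_of_smoothWitnessArc
    G r β hβ κ₂ S₀' hP2 C S₁ hSW

/-! ### §3 Temporal decay of layer autocovariances from the hypothesis alone (lead c2; LANDED p150511 `…PoincareToGapTemporalDecay`) -/

/-- **What the crux hypothesis gives with no further input: `Cov_S(A, τ_n A) ≤ κ · dir(A) / (n+1)`, `n ≤ S`.**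
On one torus `(2S+1)⁴` (`S ≥ 1`, `β ≥ 0`), if the slice Poincaré inequality of the crux holds at this `S` with
constant `κ`, then every bounded measurable gauge-invariant link-Lipschitz observable `A` of the `(2,3)`-layer
`Λ₀ = {t = 0, x₁ = 0, directions 2, 3}` has temporal autocovariances
`Cov_μ(A, A ∘ T⁰_n) ≤ κ · dir(A) / (n + 1)` for all `0 ≤ n ≤ S` — uniformly in `S`, with `dir` the crux's time-zero
Dirichlet form.  Composition: F2 feeds F3; F1 applied to `A ∘ Φ` and rewritten by F3 (ii)–(iii) is the temporal
susceptibility bound `Σ_{m ∈ ℤ_{2S+1}} c(m) ≤ κ dir A`; F4 + F4b make `c` non-negative and non-increasing on `[0, S]`,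
so `(n+1) c(n) ≤ Σ_{m ≤ n} c(m) ≤ Σ_m c(m)`. -/
theorem temporalDecay_of_slicePoincare :
    ∀ (G : Type) [Group G] [TopologicalSpace G] [IsTopologicalGroup G] [CompactSpace G]
      [MeasurableSpace G] [BorelSpace G] (r : LatticeRep G) (β : ℝ), 0 ≤ β → ∀ κ : ℝ, 0 ≤ κ → ∀ S : ℕ, 1 ≤ S →
    (∀ f : GaugeConfig 4 (2 * S + 1) G → ℝ, IsGaugeInvariant f →
      (∀ U V : GaugeConfig 4 (2 * S + 1) G,
        (∀ e : Edge 4 (2 * S + 1), e.1 0 = 0 → e.2 ≠ 0 → U e = V e) → f U = f V) →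
      (∃ K : ℝ, ∀ U V : GaugeConfig 4 (2 * S + 1) G,
        |f U - f V| ≤ K * ∑ e, Real.sqrt (∑ a, ∑ b, ‖(r.ρ (U e) - r.ρ (V e)) a b‖ ^ 2)) →
      ∫ U, (f U - ∫ V, f V ∂(wilsonMeasure r.ρ β : Measure (GaugeConfig 4 (2 * S + 1) G))) ^ 2
          ∂(wilsonMeasure r.ρ β : Measure (GaugeConfig 4 (2 * S + 1) G)) ≤
        κ * ∑ e : Edge 4 (2 * S + 1), (if e.1 0 = 0 ∧ e.2 ≠ 0 then
          ∫ U, (Filter.limsup (fun g : G => |f (Function.update U e g) - f U| /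
              Real.sqrt (∑ a, ∑ b, ‖(r.ρ g - r.ρ (U e)) a b‖ ^ 2)) (𝓝[≠] (U e))) ^ 2
            ∂(wilsonMeasure r.ρ β : Measure (GaugeConfig 4 (2 * S + 1) G)) else 0)) →
    ∀ μ : Measure (GaugeConfig 4 (2 * S + 1) G),
      μ = (wilsonMeasure r.ρ β : Measure (GaugeConfig 4 (2 * S + 1) G)) →
    ∀ A : GaugeConfig 4 (2 * S + 1) G → ℝ, Measurable A → (∃ M : ℝ, ∀ U, |A U| ≤ M) →
      IsGaugeInvariant A →
      DependsOn A {e : Edge 4 (2 * S + 1) | e.1 0 = 0 ∧ e.1 1 = 0 ∧ e.2 ≠ 0 ∧ e.2 ≠ 1} →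
      (∃ K : ℝ, ∀ U V : GaugeConfig 4 (2 * S + 1) G,
        |A U - A V| ≤ K * ∑ e, Real.sqrt (∑ a, ∑ b, ‖(r.ρ (U e) - r.ρ (V e)) a b‖ ^ 2)) →
    ∀ n : ℕ, n ≤ S →
      ∫ U, A U * A (torusConfigShift (Pi.single (0 : Fin 4) (n : ZMod (2 * S + 1)) : Site 4 (2 * S + 1)) U) ∂μ -
          (∫ U, A U ∂μ) * ∫ U, A U ∂μ ≤
        κ * (∑ e : Edge 4 (2 * S + 1), (if e.1 0 = 0 ∧ e.2 ≠ 0 then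
          ∫ U, (Filter.limsup (fun g : G => |A (Function.update U e g) - A U| /
              Real.sqrt (∑ a, ∑ b, ‖(r.ρ g - r.ρ (U e)) a b‖ ^ 2)) (𝓝[≠] (U e))) ^ 2 ∂μ else 0)) /
          ((n : ℝ) + 1) :=
  Summit.QuantumFields.YangMills.Theorems.PoincareToGap.temporalDecay_of_slicePoincare

/-! ### §3b The plaquette species of the crux's conclusion (lead c2; LANDED p152493 `…PoincareToGapPairDecay`) -/

/-- **The crux's conclusion for the `(2,3)`-plaquette pair, with `C e^{−mn}` replaced by `4κN/(n+1)`, is a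
THEOREM of the hypothesis.**  Let `O := plaquetteObservable r.ρ _ 2 3` (a `YMSpecies G`).  If `0 ≤ β`, `0 ≤ κ` and
the antecedent of `ConvexGribovBody.PoincareToGap` holds from `S₀` on, then for all `S ≥ max S₀ 1` and `n ≤ S`:
`0 ≤ latticeConnectedCorr r.ρ β (2S+1) O.F O.F n ≤ 4 κ N / (n+1)` (the instance `SecondCountableTopology G`, needed
to NAME the species, always holds: `(r.continuous.isClosedEmbedding r.injective).isEmbedding.secondCountableTopology`).
Proof: the torus correlation is
`Cov_μ(P, P ∘ T⁰_{−n})` for the torus reading `P` of `O` (`toTorusObservable_comp_configShift`), even in `n` (F4);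
`P` is an admissible `(2,3)`-layer observable with Dirichlet form `≤ 4N` (G3), so §3 applies. -/
theorem plaquetteCorr_le_of_sliceHypothesis :
    ∀ (G : Type) [Group G] [TopologicalSpace G] [IsTopologicalGroup G] [CompactSpace G]
      [MeasurableSpace G] [BorelSpace G] [SecondCountableTopology G] (r : LatticeRep G) (β : ℝ),
      0 ≤ β → ∀ κ : ℝ, 0 ≤ κ → ∀ S₀ : ℕ,
    (∀ S : ℕ, S₀ ≤ S → ∀ f : GaugeConfig 4 (2 * S + 1) G → ℝ, IsGaugeInvariant f →
      (∀ U V : GaugeConfig 4 (2 * S + 1) G,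
        (∀ e : Edge 4 (2 * S + 1), e.1 0 = 0 → e.2 ≠ 0 → U e = V e) → f U = f V) →
      (∃ K : ℝ, ∀ U V : GaugeConfig 4 (2 * S + 1) G,
        |f U - f V| ≤ K * ∑ e, Real.sqrt (∑ a, ∑ b, ‖(r.ρ (U e) - r.ρ (V e)) a b‖ ^ 2)) →
      ∫ U, (f U - ∫ V, f V ∂(wilsonMeasure r.ρ β : Measure (GaugeConfig 4 (2 * S + 1) G))) ^ 2
          ∂(wilsonMeasure r.ρ β : Measure (GaugeConfig 4 (2 * S + 1) G)) ≤
        κ * ∑ e : Edge 4 (2 * S + 1), (if e.1 0 = 0 ∧ e.2 ≠ 0 then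
          ∫ U, (Filter.limsup (fun g : G => |f (Function.update U e g) - f U| /
              Real.sqrt (∑ a, ∑ b, ‖(r.ρ g - r.ρ (U e)) a b‖ ^ 2)) (𝓝[≠] (U e))) ^ 2
            ∂(wilsonMeasure r.ρ β : Measure (GaugeConfig 4 (2 * S + 1) G)) else 0)) →
    ∀ S n : ℕ, S₀ ≤ S → 1 ≤ S → n ≤ S →
      0 ≤ latticeConnectedCorr r.ρ β (2 * S + 1) (plaquetteObservable r.ρ r.continuous 2 3).F
          (plaquetteObservable r.ρ r.continuous 2 3).F n ∧
      latticeConnectedCorr r.ρ β (2 * S + 1) (plaquetteObservable r.ρ r.continuous 2 3).F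
          (plaquetteObservable r.ρ r.continuous 2 3).F n ≤ 4 * κ * r.N / ((n : ℝ) + 1) :=
  Summit.QuantumFields.YangMills.Theorems.PoincareToGap.plaquetteCorr_le_of_sliceHypothesis

/-! ### §3c Cross-covariances of two layer observables (lead c2; LANDED p152493 `…PoincareToGapPairDecay`) -/

/-- **Pairs: `Cov_S(A, τ_n B)² ≤ 2 κ² dir(A) dir(B)/(n+1)²` for `1 ≤ n ≤ S`.**  On one torus (`S ≥ 1`, `β ≥ 0`,
`κ ≥ 0`, slice Poincaré at `S`), for two bounded measurable gauge-invariant link-Lipschitz observables `A, B` of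
the `(2,3)`-layer `Λ₀`, the temporal cross-covariance at separation `n` (`B` translated by `n` units of Euclidean
time, `T⁰_{−n}`) is bounded through reflection positivity in Cauchy–Schwarz form (G1, symmetrised; the time
reversal G2 makes the cross-covariance even in `n`; balanced split
`s = ⌈(n+1)/2⌉`, `t = n + 1 − s`) by the two autocovariances `c_A(2s−1) ≤ κ dir A/(n+1)` and
`c_B(2t−1) ≤ 2κ dir B/(n+1)` of §3 (evenness and `c(S+1) = c(S)` handle the boundary case `n = S` odd). -/
theorem crossTemporalDecay_of_slicePoincare :
    ∀ (G : Type) [Group G] [TopologicalSpace G] [IsTopologicalGroup G] [CompactSpace G]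
      [MeasurableSpace G] [BorelSpace G] (r : LatticeRep G) (β : ℝ), 0 ≤ β → ∀ κ : ℝ, 0 ≤ κ → ∀ S : ℕ, 1 ≤ S →
    (∀ f : GaugeConfig 4 (2 * S + 1) G → ℝ, IsGaugeInvariant f →
      (∀ U V : GaugeConfig 4 (2 * S + 1) G,
        (∀ e : Edge 4 (2 * S + 1), e.1 0 = 0 → e.2 ≠ 0 → U e = V e) → f U = f V) →
      (∃ K : ℝ, ∀ U V : GaugeConfig 4 (2 * S + 1) G,
        |f U - f V| ≤ K * ∑ e, Real.sqrt (∑ a, ∑ b, ‖(r.ρ (U e) - r.ρ (V e)) a b‖ ^ 2)) →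
      ∫ U, (f U - ∫ V, f V ∂(wilsonMeasure r.ρ β : Measure (GaugeConfig 4 (2 * S + 1) G))) ^ 2
          ∂(wilsonMeasure r.ρ β : Measure (GaugeConfig 4 (2 * S + 1) G)) ≤
        κ * ∑ e : Edge 4 (2 * S + 1), (if e.1 0 = 0 ∧ e.2 ≠ 0 then
          ∫ U, (Filter.limsup (fun g : G => |f (Function.update U e g) - f U| /
              Real.sqrt (∑ a, ∑ b, ‖(r.ρ g - r.ρ (U e)) a b‖ ^ 2)) (𝓝[≠] (U e))) ^ 2
            ∂(wilsonMeasure r.ρ β : Measure (GaugeConfig 4 (2 * S + 1) G)) else 0)) →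
    ∀ μ : Measure (GaugeConfig 4 (2 * S + 1) G),
      μ = (wilsonMeasure r.ρ β : Measure (GaugeConfig 4 (2 * S + 1) G)) →
    ∀ A B : GaugeConfig 4 (2 * S + 1) G → ℝ, Measurable A → Measurable B →
      (∃ M : ℝ, ∀ U, |A U| ≤ M) → (∃ M : ℝ, ∀ U, |B U| ≤ M) →
      IsGaugeInvariant A → IsGaugeInvariant B →
      DependsOn A {e : Edge 4 (2 * S + 1) | e.1 0 = 0 ∧ e.1 1 = 0 ∧ e.2 ≠ 0 ∧ e.2 ≠ 1} →
      DependsOn B {e : Edge 4 (2 * S + 1) | e.1 0 = 0 ∧ e.1 1 = 0 ∧ e.2 ≠ 0 ∧ e.2 ≠ 1} →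
      (∃ K : ℝ, ∀ U V : GaugeConfig 4 (2 * S + 1) G,
        |A U - A V| ≤ K * ∑ e, Real.sqrt (∑ a, ∑ b, ‖(r.ρ (U e) - r.ρ (V e)) a b‖ ^ 2)) →
      (∃ K : ℝ, ∀ U V : GaugeConfig 4 (2 * S + 1) G,
        |B U - B V| ≤ K * ∑ e, Real.sqrt (∑ a, ∑ b, ‖(r.ρ (U e) - r.ρ (V e)) a b‖ ^ 2)) →
    ∀ n : ℕ, 1 ≤ n → n ≤ S →
      (∫ U, A U * B (torusConfigShift (Pi.single (0 : Fin 4) (-(n : ZMod (2 * S + 1))) :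
            Site 4 (2 * S + 1)) U) ∂μ - (∫ U, A U ∂μ) * ∫ U, B U ∂μ) ^ 2 ≤
        2 * κ ^ 2 *
          (∑ e : Edge 4 (2 * S + 1), (if e.1 0 = 0 ∧ e.2 ≠ 0 then
            ∫ U, (Filter.limsup (fun g : G => |A (Function.update U e g) - A U| /
                Real.sqrt (∑ a, ∑ b, ‖(r.ρ g - r.ρ (U e)) a b‖ ^ 2)) (𝓝[≠] (U e))) ^ 2 ∂μ else 0)) *
          (∑ e : Edge 4 (2 * S + 1), (if e.1 0 = 0 ∧ e.2 ≠ 0 then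
            ∫ U, (Filter.limsup (fun g : G => |B (Function.update U e g) - B U| /
                Real.sqrt (∑ a, ∑ b, ‖(r.ρ g - r.ρ (U e)) a b‖ ^ 2)) (𝓝[≠] (U e))) ^ 2 ∂μ else 0)) /
          ((n : ℝ) + 1) ^ 2 :=
  Summit.QuantumFields.YangMills.Theorems.PoincareToGap.crossTemporalDecay_of_slicePoincare

end Summit.QuantumFields.YangMills.Cruxes.PoincareToGap.CyclicPeeling

end
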